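import Literature.NumberTheory.Automorphic.NewformAdelisation
import Literature.NumberTheory.Automorphic.UnramifiedHeckeScalars
import Literature.NumberTheory.Automorphic.AdicCompletionCompact
import Literature.NumberTheory.GaloisRepresentations.HeckeCharacterProofs
import Literature.NumberTheory.EllipticCurves.HeckeOperatorsGamma1QExpansionProofs
import HarnessLib

/-!
# Adelisation of classical modular forms, III: the double coset `K(N) diag(ϖ_p, 1) K(N)` in `GL₂(𝔸_ℚ)`

Topic `NumberTheory/Automorphic`; the local–global coset bookkeeping for the discharge of the named
fact `Literature.NumberTheory.Automorphic.adelicLift_heckeEigenvalues` (`NewformAdelisationLift`; Gelbart (1975),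
Lemma 3.7, `p^{k/2-1} T̃(p) φ_f = φ_{T(p)f}`; Bump (1997), §3.6, pp. 341–342), continuing
`NewformAdelisation` (part I: `archLift`, `GL₂(𝔸_ℚ) = GL₂(ℚ)(GL₂(ℝ)⁺ × K₁(N))`) and
`NewformAdelisationLift` (part II: `φ_f`). Everything here is group theory of `GL₂` over `ℚ`, `ℚ_p`
and `𝔸_ℚ`; no modular form appears. All statements are proved.

## Contents

* **Locality of the levels.** `GLn.localPart n K w : GL_n(𝔸_K) →* GL_n(K_w)` (the local component,
  `= (gl n K).toLocal w` with values of syntactic type `GL (Fin n) K_w`);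
  `mem_principalCongruenceLevel_iff_forall_toLocal` (`K(𝔫)` is cut out place by place); the
  **local level** `Rat.localGammaOne w 𝔫 = K₁(𝔫)_w ≤ GL₂(ℚ_w)` with its explicit description
  (`Rat.mem_localGammaOne_iff`: `x, x⁻¹` integral, `|x₁₀|_w, |x₁₁ - 1|_w ≤ |𝔫|_w`) and
  `Rat.mem_plusLevelOne_iff_forall_toLocal`: **`g ∈ GL₂(ℝ)⁺ × K₁(𝔫)` iff `det g_∞ > 0` and
  `g_w ∈ K₁(𝔫)_w` for all `w`** (Gelbart (1975), (3.2): `K_0^N = ∏_p K_p^N`); at `v ∤ 𝔫`,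
  `GL₂(𝒪_v) ≤ K₁(𝔫)_v` (`Rat.valuedCongruenceSubgroup_one_le_localGammaOne`).
* **Rational matrices at a place.** `Rat.globalToLocal n w : GL_n(ℚ) →* GL_n(ℚ_w)` (Bump's `i_p`),
  integrality of `SL₂(ℤ)` (`Rat.globalToLocal_mapGL_mem_valuedCongruenceSubgroup_one`),
  `|m|_w ≤ |p_w|_w ↔ p_w ∣ m` for integers, residues of `𝒪_w` represented by integers
  (`Rat.exists_int_valued_sub_lt_one`), `diag(p,1) ∈ K₁(𝔫)_w` and `p⁻¹γ ∈ K₁(N)_w` for `w ≠ v_p`,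
  `γ ∈ Γ₀(N)` with `d_γ ≡ p (mod N)` (the places `q ∣ N`, Gelbart (3.3)–(3.5); Bump, (6.4)).
* **The Hecke elements.** `Rat.localUniformizer v = p_v ∈ ℚ_vˣ` (`|ϖ|_v = exp(-1)`),
  `Rat.localHeckeDiag v = D_v = diag(p_v, 1) ∈ GL₂(ℚ_v)`, `Rat.diagPrime v = t₀ = diag(p_v, 1) ∈ GL₂(ℚ)`,
  `Rat.scalarPrime v = p_v · 1 ∈ GL₂(ℚ)`, with `t_{v,1}(ϖ_v) = ι_v(D_v)`, `ι_v(t₀) = D_v`,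
  `t_{v,2}(ϖ_v) = ι_v(p_v · 1)` (`Rat.heckeDiagAt_localUniformizer_one/two`); the conjugation
  lemma `Rat.localHeckeDiag_inv_mul_mul_mem_iff`: **for `M ∈ GL₂(𝒪_v)`, `D⁻¹ M D ∈ GL₂(𝒪_v)` iff
  `|M₀₁|_v ≤ |p|_v`** (the local form of Diamond–Shurman's `Γ₃ = Γ₁⁰(N, p)`, §5.2 p. 190).
* **The `p + 1` cosets.** With Diamond–Shurman's representatives `t_j = T^j` (`j < p`),
  `t_∞ = X = (pm n; N 1)` of `Γ₃ \ Γ₁(N)` (`Rat.cosetRep`, the convention `i.elim X (j ↦ T^j)` of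
  `HeckeOperatorsGamma1QExpansionProofs`): **distinctness** `Rat.cosetRep_eq_of_conj_mem` (from the
  classical `existsUnique_option`, transported through `p ∣ (t_i t_{i'}⁻¹)₀₁`) and the `p`-adic
  **exhaustion** `Rat.exists_conj_cosetRep_mul_mem` (for `κ ∈ GL₂(𝒪_v)` some `D⁻¹ ι_v(t_i) κ D`
  is integral; Gelbart (1975), proof of Lemma 3.7, "theory of elementary divisors"); hence the
  **adelic transversal** `Rat.heckeTransversal v X i = y_i = ι_v(t_i⁻¹ t₀)` of
  `K(N) t_{v,1} K(N) / K(N)` (`Rat.bijOn_heckeTransversal`, the input of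
  `heckeOperator_apply_eq_sum`; Gelbart loc. cit.: `H_p = ⊔_{b<p} (p -b; 0 1) K_p ⊔ (1 0; 0 p) K_p`;
  Bump (6.7)), and **Bump's permutation** `Rat.exists_perm_conj_mem`: for `h ∈ GL₂(𝒪_v)` there
  is a permutation `σ` of the indices with `D⁻¹ ι_v(t_{σ i}) h ι_v(t_i)⁻¹ D ∈ GL₂(𝒪_v)` for all `i`
  (p. 342: "`k₀ i_p(ξ_i) = i_p(ξ_j) k₀'`").

## References

* S. Gelbart, *Automorphic forms on adele groups*, Ann. of Math. Stud. 83 (1975), §3.A (3.2)–(3.5);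
  §3.B, (3.15), Lemma 3.7 and its proof, pp. 31–32 [Gelbart1975].
* D. Bump, *Automorphic forms and representations* (1997), §3.6, (6.4), (6.7), pp. 341–342 [Bump1997].
* F. Diamond, J. Shurman, *A first course in modular forms*, GTM 228 (2005), §5.2, pp. 190–191
  (`Γ₃ = Γ₁⁰(N,p)`, the representatives `γ_{2,j}`, `γ_{2,∞}`, Exercises 5.2.1–5.2.3) [DiamondShurman2005].
-/

noncomputable section

open Matrix NumberField IsDedekindDomain
open scoped MatrixGroups

namespace Literature.NumberTheory.Automorphic

/-! ### Locality of the level subgroups `K(𝔫)` and `GL₂(ℝ)⁺ × K₁(𝔫)` -/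

section Locality

variable {n : ℕ} {K : Type} [Field K] [NumberField K]

/-- The **local component** `g ↦ g_w`, `GL_n(𝔸_K) →* GL_n(K_w)` (`GeneralLinearGroup.map` of the
evaluation `𝔸_K → K_w`). This is `(AdelicGroupData.gl n K).toLocal w` (`AdelicGroupData.gl_toLocal`,
definitional), under a name whose values have the syntactic type `GL (Fin n) (K_w)` so that the
`GL_n` lemmas over the valued field `K_w` apply without instance mismatches. [folklore] -/
abbrev GLn.localPart (n : ℕ) (K : Type) [Field K] [NumberField K] (w : HeightOneSpectrum (𝓞 K)) :
    GL (Fin n) (AdeleRing (𝓞 K) K) →* GL (Fin n) (w.adicCompletion K) :=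
  Matrix.GeneralLinearGroup.map (AdelicGroupData.adeleEval K w)

/-- `(gl n K).toLocal w = GLn.localPart n K w` (definitional). [folklore] -/
theorem AdelicGroupData.gl_toLocal_eq_localPart (w : HeightOneSpectrum (𝓞 K)) :
    (AdelicGroupData.gl n K).toLocal w = GLn.localPart n K w :=
  rfl

/-- Entries of the local component: `(g_w)_{ij} = ((g_{ij})_f)_w`. [folklore] -/
theorem GLn.coe_localPart_apply (w : HeightOneSpectrum (𝓞 K)) (g : GL (Fin n) (AdeleRing (𝓞 K) K))
    (i j : Fin n) :
    (GLn.localPart n K w g : Matrix (Fin n) (Fin n) (w.adicCompletion K)) i j =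
      ((g : Matrix (Fin n) (Fin n) (AdeleRing (𝓞 K) K)) i j).2 w :=
  rfl

/-- `(ι_w x)_w = x`. [folklore] -/
@[simp]
theorem GLn.localPart_ofLocal (w : HeightOneSpectrum (𝓞 K)) (x : GL (Fin n) (w.adicCompletion K)) :
    GLn.localPart n K w (GLn.ofLocal n K w x) = x :=
  GLn.toLocal_ofLocal x

/-- `(ι_v x)_w = 1` for `w ≠ v`. [folklore] -/
theorem GLn.localPart_ofLocal_of_ne {v w : HeightOneSpectrum (𝓞 K)} (h : w ≠ v)
    (x : GL (Fin n) (v.adicCompletion K)) : GLn.localPart n K w (GLn.ofLocal n K v x) = 1 :=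
  GLn.toLocal_ofLocal_of_ne h x

/-- **`K(𝔫)` is defined place by place**: `g ∈ K(𝔫)` iff its archimedean part is trivial and
every local component `g_w` lies in the valued congruence subgroup of radius `|𝔫|_w` (the
integrality of the finite parts of the entries of `g, g⁻¹` required by `K^max` is the radius-`1`
part of the local conditions). [folklore] -/
theorem mem_principalCongruenceLevel_iff_forall_toLocal {𝔫 : Ideal (𝓞 K)}
    {g : GL (Fin n) (AdeleRing (𝓞 K) K)} :
    g ∈ principalCongruenceLevel n K 𝔫 ↔ GLn.fstHom n K g = 1 ∧
      ∀ w : HeightOneSpectrum (𝓞 K), GLn.localPart n K w g ∈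
        valuedCongruenceSubgroup (Fin n) (idealRadius K w 𝔫) := by
  rw [mem_principalCongruenceLevel_iff, mem_glIntegralLevel_iff, mem_glFiniteIntegralLevel_iff]
  constructor
  · rintro ⟨⟨-, h1⟩, h2⟩
    exact ⟨h1, h2⟩
  · rintro ⟨h1, h2⟩
    refine ⟨⟨⟨fun i j w => ?_, fun i j w => ?_⟩, h1⟩, h2⟩
    · exact (HeightOneSpectrum.mem_adicCompletionIntegers (R := 𝓞 K) K w).2
        ((mem_valuedCongruenceSubgroup_iff.1 (h2 w)).1 i j)
    · have h := (mem_valuedCongruenceSubgroup_iff.1 (h2 w)).2.1 i j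
      exact (HeightOneSpectrum.mem_adicCompletionIntegers (R := 𝓞 K) K w).2 h

end Locality

section RatLocality

variable (w : HeightOneSpectrum (𝓞 ℚ))

/-- The `w`-component of the finite part of the `(i,j)` entry of `ι_w(x) = GLn.ofLocal 2 ℚ w x`
is `x_{ij}`. [folklore] -/
theorem snd_coe_ofLocal_apply_self {n : ℕ} (x : GL (Fin n) (w.adicCompletion ℚ)) (i j : Fin n) :
    ((GLn.ofLocal n ℚ w x : Matrix (Fin n) (Fin n) (AdeleRing (𝓞 ℚ) ℚ)) i j).2 w =
      (x : Matrix (Fin n) (Fin n) (w.adicCompletion ℚ)) i j := by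
  rw [GLn.coe_ofLocal_apply]
  change ((1 : Matrix (Fin n) (Fin n) (AdeleRing (𝓞 ℚ) ℚ)) i j).2 w + (adeleSingleHom ℚ w _).2 w = _
  rw [adeleSingleHom_apply_snd, finiteAdeleSingleHom_apply_self,
    show ((1 : Matrix (Fin n) (Fin n) (AdeleRing (𝓞 ℚ) ℚ)) i j).2 w =
      (1 : Matrix (Fin n) (Fin n) (w.adicCompletion ℚ)) i j from adeleEval_one_apply n ℚ w i j,
    add_sub_cancel]

/-- The `w'`-component, `w' ≠ w`, of the finite part of the `(i,j)` entry of `ι_w(x)` is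
`δ_{ij}`. [folklore] -/
theorem snd_coe_ofLocal_apply_of_ne {n : ℕ} (x : GL (Fin n) (w.adicCompletion ℚ)) (i j : Fin n)
    {w' : HeightOneSpectrum (𝓞 ℚ)} (hw : w' ≠ w) :
    ((GLn.ofLocal n ℚ w x : Matrix (Fin n) (Fin n) (AdeleRing (𝓞 ℚ) ℚ)) i j).2 w' =
      (1 : Matrix (Fin n) (Fin n) (w'.adicCompletion ℚ)) i j := by
  rw [GLn.coe_ofLocal_apply]
  change ((1 : Matrix (Fin n) (Fin n) (AdeleRing (𝓞 ℚ) ℚ)) i j).2 w' + (adeleSingleHom ℚ w _).2 w' = _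
  rw [adeleSingleHom_apply_snd, finiteAdeleSingleHom_apply_of_ne ℚ w _ hw, add_zero]
  exact adeleEval_one_apply n ℚ w' i j

end RatLocality


section LocalGammaOne

variable (w : HeightOneSpectrum (𝓞 ℚ)) (𝔫 : Ideal (𝓞 ℚ))

/-- The **local level group `K₁(𝔫)_w ≤ GL₂(ℚ_w)`**: the local matrices whose image under
`ι_w = GLn.ofLocal` (identity at all other places) has finite part in `K₁(𝔫)`; explicitly
(`Rat.mem_localGammaOne_iff`) the `x ∈ GL₂(𝒪_w)` with `|x₁₀|_w ≤ |𝔫|_w`, `|x₁₁ - 1|_w ≤ |𝔫|_w`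
(Gelbart (1975), (3.2): `K_p^N`; Bump (1997), §3.6: `K₀(N) = ∏_p K₀(N)_p`, here for `K₁`). [cite: Gelbart1975, (3.2)] -/
def Rat.localGammaOne : Subgroup (GL (Fin 2) (w.adicCompletion ℚ)) :=
  (gammaOneFiniteLevel ℚ 𝔫).comap ((GLn.sndHom 2 ℚ).comp (GLn.ofLocal 2 ℚ w))

variable {w 𝔫}

/-- Membership in `K₁(𝔫)_w` (definitional). [folklore] -/
theorem Rat.mem_localGammaOne_iff' {x : GL (Fin 2) (w.adicCompletion ℚ)} :
    x ∈ Rat.localGammaOne w 𝔫 ↔ GLn.sndHom 2 ℚ (GLn.ofLocal 2 ℚ w x) ∈ gammaOneFiniteLevel ℚ 𝔫 :=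
  Iff.rfl

/-- **Explicit membership in `K₁(𝔫)_w`**: `x, x⁻¹` integral, `|x₁₀|_w ≤ |𝔫|_w` and
`|x₁₁ - 1|_w ≤ |𝔫|_w` (at the other places `ι_w(x)` is the identity, which satisfies every
condition). [folklore] -/
theorem Rat.mem_localGammaOne_iff {x : GL (Fin 2) (w.adicCompletion ℚ)} :
    x ∈ Rat.localGammaOne w 𝔫 ↔
      (∀ i j, Valued.v ((x : Matrix (Fin 2) (Fin 2) (w.adicCompletion ℚ)) i j) ≤ 1) ∧
      (∀ i j, Valued.v (((x⁻¹ : GL (Fin 2) (w.adicCompletion ℚ)) :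
        Matrix (Fin 2) (Fin 2) (w.adicCompletion ℚ)) i j) ≤ 1) ∧
      Valued.v ((x : Matrix (Fin 2) (Fin 2) (w.adicCompletion ℚ)) 1 0) ≤ idealRadius ℚ w 𝔫 ∧
      Valued.v ((x : Matrix (Fin 2) (Fin 2) (w.adicCompletion ℚ)) 1 1 - 1) ≤ idealRadius ℚ w 𝔫 := by
  rw [Rat.mem_localGammaOne_iff', mem_gammaOneFiniteLevel_iff, mem_gammaZeroFiniteLevel_iff,
    mem_eichlerOrder_iff, mem_eichlerOrder_iff, ← map_inv, ← map_inv]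
  -- the entries of the finite part of `ι_w(y)`, `y = x, x⁻¹`
  have hint : ∀ y : GL (Fin 2) (w.adicCompletion ℚ),
      (∀ i j, (GLn.sndHom 2 ℚ (GLn.ofLocal 2 ℚ w y) : Matrix (Fin 2) (Fin 2)
        (FiniteAdeleRing (𝓞 ℚ) ℚ)) i j ∈ integralFiniteAdeles ℚ) ↔
      ∀ i j, Valued.v ((y : Matrix (Fin 2) (Fin 2) (w.adicCompletion ℚ)) i j) ≤ 1 := by
    intro y
    refine forall_congr' fun i => forall_congr' fun j => ?_
    change (∀ w', ((GLn.ofLocal 2 ℚ w y : Matrix (Fin 2) (Fin 2) (AdeleRing (𝓞 ℚ) ℚ)) i j).2 w' ∈ _) ↔ _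
    constructor
    · intro h
      have := h w
      rwa [snd_coe_ofLocal_apply_self, HeightOneSpectrum.mem_adicCompletionIntegers] at this
    · intro h w'
      by_cases hw : w' = w
      · subst hw
        rwa [snd_coe_ofLocal_apply_self, HeightOneSpectrum.mem_adicCompletionIntegers]
      · rw [snd_coe_ofLocal_apply_of_ne w y i j hw, Matrix.one_apply]
        split_ifs <;> simp
  have h10 : ∀ y : GL (Fin 2) (w.adicCompletion ℚ),
      (GLn.sndHom 2 ℚ (GLn.ofLocal 2 ℚ w y) : Matrix (Fin 2) (Fin 2)
        (FiniteAdeleRing (𝓞 ℚ) ℚ)) 1 0 ∈ levelIdeal ℚ 𝔫 ↔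
      Valued.v ((y : Matrix (Fin 2) (Fin 2) (w.adicCompletion ℚ)) 1 0) ≤ idealRadius ℚ w 𝔫 := by
    intro y
    rw [mem_levelIdeal_iff]
    change (∀ w', Valued.v (((GLn.ofLocal 2 ℚ w y : Matrix (Fin 2) (Fin 2) (AdeleRing (𝓞 ℚ) ℚ)) 1 0).2 w') ≤ _) ↔ _
    constructor
    · intro h
      have := h w
      rwa [snd_coe_ofLocal_apply_self] at this
    · intro h w'
      by_cases hw : w' = w
      · subst hw
        rwa [snd_coe_ofLocal_apply_self]
      · rw [snd_coe_ofLocal_apply_of_ne w y 1 0 hw, Matrix.one_apply_ne (by decide), map_zero]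
        exact zero_le
  have h11 : (GLn.sndHom 2 ℚ (GLn.ofLocal 2 ℚ w x) : Matrix (Fin 2) (Fin 2)
        (FiniteAdeleRing (𝓞 ℚ) ℚ)) 1 1 - 1 ∈ levelIdeal ℚ 𝔫 ↔
      Valued.v ((x : Matrix (Fin 2) (Fin 2) (w.adicCompletion ℚ)) 1 1 - 1) ≤ idealRadius ℚ w 𝔫 := by
    rw [mem_levelIdeal_iff]
    have e : ∀ w', ((GLn.sndHom 2 ℚ (GLn.ofLocal 2 ℚ w x) : Matrix (Fin 2) (Fin 2)
        (FiniteAdeleRing (𝓞 ℚ) ℚ)) 1 1 - 1) w' =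
        ((GLn.ofLocal 2 ℚ w x : Matrix (Fin 2) (Fin 2) (AdeleRing (𝓞 ℚ) ℚ)) 1 1).2 w' - 1 := fun w' => rfl
    simp_rw [e]
    constructor
    · intro h
      have := h w
      rwa [snd_coe_ofLocal_apply_self] at this
    · intro h w'
      by_cases hw : w' = w
      · subst hw
        rwa [snd_coe_ofLocal_apply_self]
      · rw [snd_coe_ofLocal_apply_of_ne w x 1 1 hw, Matrix.one_apply_eq, sub_self, map_zero]
        exact zero_le
  -- the `(1,0)` condition for `x⁻¹` is implied by the others:
  -- `(x⁻¹)₁₀ = -x₁₀ / det x` with `det x` a unit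
  rw [hint x, hint x⁻¹, h10 x, h10 x⁻¹, h11]
  constructor
  · rintro ⟨⟨⟨h1, h2⟩, h3, -⟩, h4⟩
    exact ⟨h1, h3, h2, h4⟩
  · rintro ⟨h1, h3, h2, h4⟩
    refine ⟨⟨⟨h1, h2⟩, h3, ?_⟩, h4⟩
    -- `(x⁻¹)₁₀ = -(det x)⁻¹ x₁₀`
    have hdet : Valued.v (((x⁻¹ : GL (Fin 2) (w.adicCompletion ℚ)) :
        Matrix (Fin 2) (Fin 2) (w.adicCompletion ℚ)).det) ≤ 1 := by
      rw [Matrix.det_fin_two]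
      refine (Valued.v.map_sub _ _).trans (max_le ?_ ?_) <;> rw [map_mul]
      · exact mul_le_one' (h3 0 0) (h3 1 1)
      · exact mul_le_one' (h3 0 1) (h3 1 0)
    have hadj : ((x⁻¹ : GL (Fin 2) (w.adicCompletion ℚ)) : Matrix (Fin 2) (Fin 2) (w.adicCompletion ℚ)) 1 0 =
        -(((x⁻¹ : GL (Fin 2) (w.adicCompletion ℚ)) : Matrix (Fin 2) (Fin 2) (w.adicCompletion ℚ)).det *
          (x : Matrix (Fin 2) (Fin 2) (w.adicCompletion ℚ)) 1 0) := by
      rw [Matrix.coe_units_inv, Matrix.det_nonsing_inv, Matrix.inv_def, Matrix.adjugate_fin_two,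
        Matrix.smul_apply, smul_eq_mul]
      simp only [Matrix.of_apply, Matrix.cons_val', Matrix.cons_val_one, Matrix.cons_val_zero,
        Matrix.empty_val', Matrix.cons_val_fin_one]
      ring
    rw [hadj, Valuation.map_neg, map_mul]
    calc _ ≤ 1 * idealRadius ℚ w 𝔫 := mul_le_mul' hdet h2
      _ = _ := one_mul _

end LocalGammaOne


section PlusLevelLocal

variable {𝔫 : Ideal (𝓞 ℚ)}

/-- **`K₁(𝔫)` is defined place by place**: the finite part of `g ∈ GL₂(𝔸_ℚ)` lies in `K₁(𝔫)`
iff every local component `g_w` lies in `K₁(𝔫)_w` (Bump (1997), §3.6: `K₀(N) = ∏ K₀(N)_p`;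
Gelbart (1975), (3.2)). [cite: Gelbart1975, (3.2)] -/
theorem Rat.sndHom_mem_gammaOneFiniteLevel_iff_forall_toLocal {g : GL (Fin 2) (AdeleRing (𝓞 ℚ) ℚ)} :
    GLn.sndHom 2 ℚ g ∈ gammaOneFiniteLevel ℚ 𝔫 ↔
      ∀ w : HeightOneSpectrum (𝓞 ℚ), GLn.localPart 2 ℚ w g ∈ Rat.localGammaOne w 𝔫 := by
  -- both sides, unfolded, are the same family of local conditions on the components `(g_{ij})_w`
  have key : ∀ w : HeightOneSpectrum (𝓞 ℚ), GLn.localPart 2 ℚ w g ∈ Rat.localGammaOne w 𝔫 ↔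
      (∀ i j, Valued.v ((((g : Matrix (Fin 2) (Fin 2) (AdeleRing (𝓞 ℚ) ℚ)) i j).2) w) ≤ 1) ∧
      (∀ i j, Valued.v (((((g⁻¹ : GL (Fin 2) (AdeleRing (𝓞 ℚ) ℚ)) :
        Matrix (Fin 2) (Fin 2) (AdeleRing (𝓞 ℚ) ℚ)) i j).2) w) ≤ 1) ∧
      Valued.v ((((g : Matrix (Fin 2) (Fin 2) (AdeleRing (𝓞 ℚ) ℚ)) 1 0).2) w) ≤ idealRadius ℚ w 𝔫 ∧
      Valued.v ((((g : Matrix (Fin 2) (Fin 2) (AdeleRing (𝓞 ℚ) ℚ)) 1 1).2) w - 1) ≤ idealRadius ℚ w 𝔫 := by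
    intro w
    rw [Rat.mem_localGammaOne_iff]
    rfl
  simp_rw [key]
  rw [mem_gammaOneFiniteLevel_iff, mem_gammaZeroFiniteLevel_iff, mem_eichlerOrder_iff,
    mem_eichlerOrder_iff, ← map_inv]
  have e11 : ∀ w, ((GLn.sndHom 2 ℚ g : Matrix (Fin 2) (Fin 2) (FiniteAdeleRing (𝓞 ℚ) ℚ)) 1 1 - 1) w =
      (((g : Matrix (Fin 2) (Fin 2) (AdeleRing (𝓞 ℚ) ℚ)) 1 1).2) w - 1 := fun w => rfl
  constructor
  · rintro ⟨⟨⟨h1, h2⟩, h3, -⟩, h4⟩ w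
    refine ⟨fun i j => ?_, fun i j => ?_, ?_, ?_⟩
    · exact (HeightOneSpectrum.mem_adicCompletionIntegers (R := 𝓞 ℚ) ℚ w).1 (h1 i j w)
    · exact (HeightOneSpectrum.mem_adicCompletionIntegers (R := 𝓞 ℚ) ℚ w).1 (h3 i j w)
    · exact (mem_levelIdeal_iff.1 h2) w
    · rw [← e11]; exact (mem_levelIdeal_iff.1 h4) w
  · intro h
    refine ⟨⟨⟨fun i j w => ?_, mem_levelIdeal_iff.2 fun w => (h w).2.2.1⟩, fun i j w => ?_,
      mem_levelIdeal_iff.2 fun w => ?_⟩, mem_levelIdeal_iff.2 fun w => ?_⟩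
    · exact (HeightOneSpectrum.mem_adicCompletionIntegers (R := 𝓞 ℚ) ℚ w).2 ((h w).1 i j)
    · exact (HeightOneSpectrum.mem_adicCompletionIntegers (R := 𝓞 ℚ) ℚ w).2 ((h w).2.1 i j)
    · -- the `(1,0)` entry of `g⁻¹`: use `g_w⁻¹ ∈ K₁(𝔫)_w`
      have hinv := (Rat.mem_localGammaOne_iff.1 (inv_mem ((key w).2 (h w)))).2.2.1
      exact hinv
    · rw [e11]; exact (h w).2.2.2

/-- **`GL₂(ℝ)⁺ × K₁(𝔫)` is defined place by place**: `g ∈ GL₂(ℝ)⁺ × K₁(𝔫)` iff `det g_∞ > 0` and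
`g_w ∈ K₁(𝔫)_w` for every finite place `w`. [cite: Gelbart1975, (3.2)] -/
theorem Rat.mem_plusLevelOne_iff_forall_toLocal {g : GL (Fin 2) (AdeleRing (𝓞 ℚ) ℚ)} :
    g ∈ Rat.plusLevelOne 𝔫 ↔ 0 < (Rat.archGL 2 g).det.val ∧
      ∀ w : HeightOneSpectrum (𝓞 ℚ), GLn.localPart 2 ℚ w g ∈ Rat.localGammaOne w 𝔫 := by
  rw [Rat.mem_plusLevelOne_iff, Rat.sndHom_mem_gammaOneFiniteLevel_iff_forall_toLocal]

/-- Elements of `Γ₁(N)` (diagonally embedded) have all their local components in `K₁(N)_w`. [cite: Gelbart1975, (3.5)] -/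
theorem Rat.localPart_ofGlobal_mapGL_mem_localGammaOne {N : ℕ} [NeZero N] {A : SL(2, ℤ)}
    (hA : A ∈ CongruenceSubgroup.Gamma1 N) (w : HeightOneSpectrum (𝓞 ℚ)) :
    GLn.localPart 2 ℚ w (GLn.ofGlobal 2 ℚ (Matrix.SpecialLinearGroup.mapGL ℚ A)) ∈
      Rat.localGammaOne w (Ideal.span {(N : 𝓞 ℚ)}) :=
  (Rat.mem_plusLevelOne_iff_forall_toLocal.1 (Rat.ofGlobal_mapGL_mem_plusLevelOne hA)).2 w

/-- **At a place `v ∤ 𝔫` the local level `K₁(𝔫)_v` contains `GL₂(𝒪_v)`** (`|𝔫|_v = 1`; via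
`K(𝔫) ⊆ {1} × K₁(𝔫)` and the maximality of `K(𝔫)` at `v`). [folklore] -/
theorem Rat.valuedCongruenceSubgroup_one_le_localGammaOne {𝔫 : Ideal (𝓞 ℚ)} (h𝔫 : 𝔫 ≠ 0)
    {v : HeightOneSpectrum (𝓞 ℚ)} (hv : ¬ v.asIdeal ∣ 𝔫) :
    valuedCongruenceSubgroup (Fin 2) (1 : WithZero (Multiplicative ℤ)) ≤ Rat.localGammaOne v 𝔫 :=
  fun _ hx => Rat.sndHom_mem_gammaOneFiniteLevel_of_mem_principalCongruenceLevel
    (isMaximalAt_principalCongruenceLevel 2 ℚ v h𝔫 hv ⟨_, hx, rfl⟩)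

/-- The local level is contained in `GL₂(𝒪_w)`. [folklore] -/
theorem Rat.localGammaOne_le_valuedCongruenceSubgroup_one (w : HeightOneSpectrum (𝓞 ℚ)) (𝔫 : Ideal (𝓞 ℚ)) :
    Rat.localGammaOne w 𝔫 ≤ valuedCongruenceSubgroup (Fin 2) (1 : WithZero (Multiplicative ℤ)) := by
  intro x hx
  rw [Rat.mem_localGammaOne_iff] at hx
  refine ⟨hx.1, hx.2.1, fun i j => ?_⟩
  rw [Matrix.sub_apply]
  refine (Valued.v.map_sub _ _).trans (max_le (hx.1 i j) ?_)
  rw [Matrix.one_apply]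
  split_ifs <;> simp

end PlusLevelLocal


/-! ### Rational matrices at a finite place -/

section GlobalToLocal

open Rat.HeightOneSpectrum

variable (n : ℕ) (w : HeightOneSpectrum (𝓞 ℚ))

/-- The localisation `GL_n(ℚ) →* GL_n(ℚ_w)` of rational matrices at the finite place `w`
(entrywise `ℚ → ℚ_w`; Bump (1997), §3.6: `i_p : GL(2,ℚ) → GL(2,ℚ_p)`). [folklore] -/
abbrev Rat.globalToLocal : GL (Fin n) ℚ →* GL (Fin n) (w.adicCompletion ℚ) :=
  Matrix.GeneralLinearGroup.map (algebraMap ℚ (w.adicCompletion ℚ))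

variable {n w}

/-- The local component at `w` of a diagonally embedded rational matrix is its localisation at `w`. [folklore] -/
@[simp]
theorem GLn.localPart_ofGlobal (γ : GL (Fin n) ℚ) :
    GLn.localPart n ℚ w (GLn.ofGlobal n ℚ γ) = Rat.globalToLocal n w γ := by
  refine Matrix.GeneralLinearGroup.ext fun i j => ?_
  rfl

/-- The local component of `(g_∞, 1)` is trivial. [folklore] -/
@[simp]
theorem GLn.localPart_ofRealGL (g : GL (Fin n) ℝ) : GLn.localPart n ℚ w (Rat.ofRealGL n g) = 1 := by
  refine Matrix.GeneralLinearGroup.ext fun i j => ?_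
  rw [GLn.coe_localPart_apply]
  have h : ((Rat.ofRealGL n g : Matrix (Fin n) (Fin n) (AdeleRing (𝓞 ℚ) ℚ)) i j).2 =
      ((GLn.sndHom n ℚ (Rat.ofRealGL n g) : GL (Fin n) (FiniteAdeleRing (𝓞 ℚ) ℚ)) :
        Matrix (Fin n) (Fin n) (FiniteAdeleRing (𝓞 ℚ) ℚ)) i j := rfl
  rw [h, Rat.sndHom_ofRealGL, Units.val_one, Matrix.one_apply, Units.val_one, Matrix.one_apply]
  split_ifs <;> rfl

/-- Valuation of an integer at `w`: `|m|_w ≤ |p_w|_w = exp(-1)` iff `p_w ∣ m`. [folklore] -/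
theorem Rat.valued_intCast_le_exp_neg_one_iff (m : ℤ) :
    Valued.v ((m : ℤ) : w.adicCompletion ℚ) ≤ WithZero.exp (-1 : ℤ) ↔ (natGenerator w : ℤ) ∣ m := by
  rw [← map_intCast (algebraMap ℚ (w.adicCompletion ℚ)), Literature.NumberTheory.GaloisRepresentations.valued_algebraMap_adicCompletion]
  constructor
  · intro h
    by_contra hnd
    rw [GaloisRepresentations.Rat.valuation_intCast_eq_one w hnd, ← WithZero.exp_zero, WithZero.exp_le_exp] at h
    norm_num at h
  · intro h
    have := GaloisRepresentations.Rat.valuation_intCast_le w (e := 1) (by simpa using h)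
    simpa using this

/-- Integers are `w`-integral. [folklore] -/
theorem Rat.valued_intCast_le_one (m : ℤ) : Valued.v ((m : ℤ) : w.adicCompletion ℚ) ≤ 1 := by
  rw [← map_intCast (algebraMap ℚ (w.adicCompletion ℚ)), Literature.NumberTheory.GaloisRepresentations.valued_algebraMap_adicCompletion,
    ← map_intCast (algebraMap (𝓞 ℚ) ℚ), HeightOneSpectrum.valuation_of_algebraMap]
  exact HeightOneSpectrum.intValuation_le_one w _

/-- Integers divisible by `p_w` lie in the maximal ideal of `𝒪_w`. [folklore] -/
theorem Rat.valued_intCast_lt_one_of_dvd {m : ℤ} (h : (natGenerator w : ℤ) ∣ m) :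
    Valued.v ((m : ℤ) : w.adicCompletion ℚ) < 1 := by
  refine lt_of_le_of_lt ((Rat.valued_intCast_le_exp_neg_one_iff m).2 h) ?_
  rw [← WithZero.exp_zero, WithZero.exp_lt_exp]
  norm_num

/-- Entries of the localisation of `mapGL ℚ A`, `A ∈ SL₂(ℤ)`, are the integer entries of `A`. [folklore] -/
theorem Rat.coe_globalToLocal_mapGL_apply (A : SL(2, ℤ)) (i j : Fin 2) :
    (Rat.globalToLocal 2 w (Matrix.SpecialLinearGroup.mapGL ℚ A) :
      Matrix (Fin 2) (Fin 2) (w.adicCompletion ℚ)) i j =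
      (((A : Matrix (Fin 2) (Fin 2) ℤ) i j : ℤ) : w.adicCompletion ℚ) := by
  rw [Matrix.GeneralLinearGroup.map_apply]
  change algebraMap ℚ (w.adicCompletion ℚ) (((A : Matrix (Fin 2) (Fin 2) ℤ) i j : ℤ) : ℚ) = _
  rw [map_intCast]

/-- **Integer matrices of determinant `1` are `w`-integral**: the localisation of `A ∈ SL₂(ℤ)`
lies in `GL₂(𝒪_w)`. [folklore] -/
theorem Rat.globalToLocal_mapGL_mem_valuedCongruenceSubgroup_one (A : SL(2, ℤ)) :
    Rat.globalToLocal 2 w (Matrix.SpecialLinearGroup.mapGL ℚ A) ∈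
      valuedCongruenceSubgroup (Fin 2) (1 : WithZero (Multiplicative ℤ)) := by
  have hint : ∀ (B : SL(2, ℤ)) i j, Valued.v ((Rat.globalToLocal 2 w (Matrix.SpecialLinearGroup.mapGL ℚ B) :
      Matrix (Fin 2) (Fin 2) (w.adicCompletion ℚ)) i j) ≤ 1 := fun B i j => by
    rw [Rat.coe_globalToLocal_mapGL_apply]
    exact Rat.valued_intCast_le_one _
  refine ⟨hint A, fun i j => ?_, fun i j => ?_⟩
  · rw [← map_inv, ← map_inv]
    exact hint A⁻¹ i j
  · rw [Matrix.sub_apply]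
    refine (Valued.v.map_sub _ _).trans (max_le (hint A i j) ?_)
    rw [Matrix.one_apply]
    split_ifs <;> simp

/-- **Residues of `𝒪_w` are represented by integers**: every `x ∈ 𝒪_w ⊆ ℚ_w` is congruent
modulo `𝓂_w` to (the image of) a rational integer (`ℤ = 𝓞 ℚ` is dense in `ℤ_p`;
`exists_ringOfIntegers_valued_sub_lt_one`). [folklore] -/
theorem Rat.exists_int_valued_sub_lt_one {x : w.adicCompletion ℚ} (hx : Valued.v x ≤ 1) :
    ∃ m : ℤ, Valued.v (x - ((m : ℤ) : w.adicCompletion ℚ)) < 1 := by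
  obtain ⟨a, ha⟩ := exists_ringOfIntegers_valued_sub_lt_one ℚ w ⟨x, hx⟩
  refine ⟨Rat.ringOfIntegersEquiv a, ?_⟩
  rw [← Valuation.map_neg, neg_sub, ← map_intCast (algebraMap ℚ (w.adicCompletion ℚ)),
    Rat.ringOfIntegersEquiv_apply_coe]
  exact ha

end GlobalToLocal


/-! ### The Hecke element `t_{v,1}` at a place of `ℚ` and conjugation by `diag(p, 1)` -/

section HeckeElement

open Rat.HeightOneSpectrum

variable (v : HeightOneSpectrum (𝓞 ℚ))

/-- The **uniformizer `ϖ_v = p_v ∈ ℚ_vˣ`**, the rational prime under `v` (`|p_v|_v = exp(-1)`,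
`Rat.valued_localUniformizer`); the choice of `ϖ` in `adelicLift_heckeEigenvalues`
(Bump (1997), p. 341: "`ϖ_p` is the idele whose `v_p`th component is `p`"). [folklore] -/
def Rat.localUniformizer : (v.adicCompletion ℚ)ˣ :=
  Units.mk0 ((natGenerator v : ℕ) : v.adicCompletion ℚ) (GaloisRepresentations.Rat.natGenerator_ne_zero' v)

/-- `ϖ_v = p_v` in `ℚ_v`. [folklore] -/
@[simp]
theorem Rat.val_localUniformizer :
    (Rat.localUniformizer v : v.adicCompletion ℚ) = ((natGenerator v : ℕ) : v.adicCompletion ℚ) :=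
  rfl

/-- `|ϖ_v|_v = exp(-1)`. [folklore] -/
theorem Rat.valued_localUniformizer :
    Valued.v (Rat.localUniformizer v : v.adicCompletion ℚ) = WithZero.exp (-1 : ℤ) :=
  GaloisRepresentations.Rat.valued_natGenerator v

/-- `|ϖ_v|_v < 1`. [folklore] -/
theorem Rat.valued_localUniformizer_lt_one :
    Valued.v (Rat.localUniformizer v : v.adicCompletion ℚ) < 1 := by
  rw [Rat.valued_localUniformizer, ← WithZero.exp_zero, WithZero.exp_lt_exp]
  norm_num

/-- The diagonal entries `(ϖ_v, 1)` of the local Hecke matrix `diag(ϖ_v, 1)`. [folklore] -/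
def Rat.heckeDiagEntries : Fin 2 → (v.adicCompletion ℚ)ˣ :=
  fun k => if (k : ℕ) < 1 then Rat.localUniformizer v else 1

/-- The **local Hecke matrix `D_v = diag(ϖ_v, 1) ∈ GL₂(ℚ_v)`** (Gelbart (1975), §3.B:
`H_p = K_p diag(p,1) K_p`). [cite: Gelbart1975, §3.B, (3.15)] -/
def Rat.localHeckeDiag : GL (Fin 2) (v.adicCompletion ℚ) :=
  glDiagonal 2 (v.adicCompletion ℚ) (Rat.heckeDiagEntries v)

/-- The matrix of `D_v` is `diag(p_v, 1)`. [folklore] -/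
theorem Rat.coe_localHeckeDiag :
    (Rat.localHeckeDiag v : Matrix (Fin 2) (Fin 2) (v.adicCompletion ℚ)) =
      Matrix.diagonal ![((natGenerator v : ℕ) : v.adicCompletion ℚ), 1] := by
  rw [Rat.localHeckeDiag, coe_glDiagonal]
  congr 1
  funext k
  fin_cases k <;> simp [Rat.heckeDiagEntries]

/-- The matrix of `D_v⁻¹` is `diag(p_v⁻¹, 1)`. [folklore] -/
theorem Rat.coe_localHeckeDiag_inv :
    (((Rat.localHeckeDiag v)⁻¹ : GL (Fin 2) (v.adicCompletion ℚ)) :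
        Matrix (Fin 2) (Fin 2) (v.adicCompletion ℚ)) =
      Matrix.diagonal ![(((natGenerator v : ℕ) : v.adicCompletion ℚ))⁻¹, 1] := by
  rw [Rat.localHeckeDiag, ← map_inv, coe_glDiagonal]
  congr 1
  funext k
  fin_cases k <;> simp [Rat.heckeDiagEntries]

/-- **The adelic Hecke element is local**: `t_{v,1}(ϖ_v) = ι_v(D_v)`
(`heckeDiagAt_eq_ofLocal_glDiagonal`). [folklore] -/
theorem Rat.heckeDiagAt_localUniformizer_one :
    heckeDiagAt 2 ℚ v (Rat.localUniformizer v) 1 = GLn.ofLocal 2 ℚ v (Rat.localHeckeDiag v) :=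
  heckeDiagAt_eq_ofLocal_glDiagonal (Rat.localUniformizer v) 1

/-- The rational matrix **`t₀ = diag(p_v, 1) ∈ GL₂(ℚ)⁺`** (`diagGL` of `HeckeOperators`), whose
localisation at `v` is `D_v` and whose real image is Diamond–Shurman's `diag(p, 1)`. [folklore] -/
def Rat.diagPrime : GL (Fin 2) ℚ :=
  (Literature.NumberTheory.EllipticCurves.ModularForms.diagGL (natGenerator v : ℚ) 1
    (Nat.cast_pos.2 (prime_natGenerator v).pos) one_pos : GL(2, ℚ)⁺)

/-- The matrix of `t₀` is `diag(p_v, 1)`. [folklore] -/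
@[simp]
theorem Rat.coe_diagPrime :
    (Rat.diagPrime v : Matrix (Fin 2) (Fin 2) ℚ) = !![(natGenerator v : ℚ), 0; 0, 1] :=
  rfl

/-- The localisation of `t₀ = diag(p_v, 1)` at `v` is `D_v`. [folklore] -/
theorem Rat.globalToLocal_diagPrime :
    Rat.globalToLocal 2 v (Rat.diagPrime v) = Rat.localHeckeDiag v := by
  refine Matrix.GeneralLinearGroup.ext fun i j => ?_
  rw [Matrix.GeneralLinearGroup.map_apply, Rat.coe_diagPrime, Rat.coe_localHeckeDiag]
  fin_cases i <;> fin_cases j <;> simp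

variable {v}

/-- Entries of a conjugate `D_v⁻¹ M D_v = (m₀₀, m₀₁/p; p m₁₀, m₁₁)`. [folklore] -/
theorem Rat.coe_localHeckeDiag_inv_mul_mul (M : GL (Fin 2) (v.adicCompletion ℚ)) (i j : Fin 2) :
    (((Rat.localHeckeDiag v)⁻¹ * M * Rat.localHeckeDiag v : GL (Fin 2) (v.adicCompletion ℚ)) :
      Matrix (Fin 2) (Fin 2) (v.adicCompletion ℚ)) i j =
      ![(((natGenerator v : ℕ) : v.adicCompletion ℚ))⁻¹, 1] i *
        (M : Matrix (Fin 2) (Fin 2) (v.adicCompletion ℚ)) i j *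
        ![((natGenerator v : ℕ) : v.adicCompletion ℚ), 1] j := by
  rw [Units.val_mul, Units.val_mul, Rat.coe_localHeckeDiag, Rat.coe_localHeckeDiag_inv,
    Matrix.mul_diagonal, Matrix.diagonal_mul]

/-- The `(0,1)` entry of the inverse of `M ∈ GL₂(𝒪_v)` has the valuation of `M₀₁`
(`(M⁻¹)₀₁ = -M₀₁ / det M`, `det M ∈ 𝒪_vˣ`). [folklore] -/
theorem Rat.valued_inv_apply_zero_one_le {M : GL (Fin 2) (v.adicCompletion ℚ)}
    (hM : M ∈ valuedCongruenceSubgroup (Fin 2) (1 : WithZero (Multiplicative ℤ))) :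
    Valued.v (((M⁻¹ : GL (Fin 2) (v.adicCompletion ℚ)) : Matrix (Fin 2) (Fin 2) (v.adicCompletion ℚ)) 0 1) ≤
      Valued.v ((M : Matrix (Fin 2) (Fin 2) (v.adicCompletion ℚ)) 0 1) := by
  have hdet : Valued.v (((M⁻¹ : GL (Fin 2) (v.adicCompletion ℚ)) :
      Matrix (Fin 2) (Fin 2) (v.adicCompletion ℚ)).det) ≤ 1 := by
    have h3 := (mem_valuedCongruenceSubgroup_iff.1 hM).2.1
    rw [Matrix.det_fin_two]
    refine (Valued.v.map_sub _ _).trans (max_le ?_ ?_) <;> rw [map_mul]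
    · exact mul_le_one' (h3 0 0) (h3 1 1)
    · exact mul_le_one' (h3 0 1) (h3 1 0)
  have hadj : ((M⁻¹ : GL (Fin 2) (v.adicCompletion ℚ)) : Matrix (Fin 2) (Fin 2) (v.adicCompletion ℚ)) 0 1 =
      -(((M⁻¹ : GL (Fin 2) (v.adicCompletion ℚ)) : Matrix (Fin 2) (Fin 2) (v.adicCompletion ℚ)).det *
        (M : Matrix (Fin 2) (Fin 2) (v.adicCompletion ℚ)) 0 1) := by
    rw [Matrix.coe_units_inv, Matrix.det_nonsing_inv, Matrix.inv_def, Matrix.adjugate_fin_two,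
      Matrix.smul_apply, smul_eq_mul]
    simp only [Matrix.of_apply, Matrix.cons_val', Matrix.cons_val_one, Matrix.cons_val_zero,
      Matrix.empty_val', Matrix.cons_val_fin_one]
    ring
  rw [hadj, Valuation.map_neg, map_mul]
  calc _ ≤ 1 * Valued.v ((M : Matrix (Fin 2) (Fin 2) (v.adicCompletion ℚ)) 0 1) := mul_le_mul' hdet le_rfl
    _ = _ := one_mul _

/-- **Conjugation by `D_v = diag(p, 1)`**: for `M ∈ GL₂(𝒪_v)`, `D_v⁻¹ M D_v ∈ GL₂(𝒪_v)` iff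
`|M₀₁|_v ≤ |p|_v`, i.e. `p ∣ M₀₁` (`D⁻¹ M D = (m₀₀, m₀₁/p; p m₁₀, m₁₁)`; the condition
`b ≡ 0 (mod p)` cutting out `GL₂(ℤ_p) ∩ D GL₂(ℤ_p) D⁻¹`, the local form of Diamond–Shurman's
`Γ₃ = Γ₁⁰(N, p)`, §5.2 p. 170). [folklore] -/
theorem Rat.localHeckeDiag_inv_mul_mul_mem_iff {M : GL (Fin 2) (v.adicCompletion ℚ)}
    (hM : M ∈ valuedCongruenceSubgroup (Fin 2) (1 : WithZero (Multiplicative ℤ))) :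
    (Rat.localHeckeDiag v)⁻¹ * M * Rat.localHeckeDiag v ∈
        valuedCongruenceSubgroup (Fin 2) (1 : WithZero (Multiplicative ℤ)) ↔
      Valued.v ((M : Matrix (Fin 2) (Fin 2) (v.adicCompletion ℚ)) 0 1) ≤ WithZero.exp (-1 : ℤ) := by
  have hp : Valued.v ((natGenerator v : ℕ) : v.adicCompletion ℚ) = WithZero.exp (-1 : ℤ) :=
    GaloisRepresentations.Rat.valued_natGenerator v
  have hp0 : ((natGenerator v : ℕ) : v.adicCompletion ℚ) ≠ 0 := GaloisRepresentations.Rat.natGenerator_ne_zero' v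
  have hp1 : Valued.v ((natGenerator v : ℕ) : v.adicCompletion ℚ) ≤ 1 := by
    rw [hp, ← WithZero.exp_zero, WithZero.exp_le_exp]; norm_num
  -- the key equivalence for the `(0,1)` entry
  have key : ∀ y : v.adicCompletion ℚ,
      Valued.v ((((natGenerator v : ℕ) : v.adicCompletion ℚ))⁻¹ * y * 1) ≤ 1 ↔
        Valued.v y ≤ WithZero.exp (-1 : ℤ) := by
    intro y
    rw [mul_one, map_mul, map_inv₀, hp, ← WithZero.exp_neg, neg_neg]
    constructor
    · intro h
      have : WithZero.exp (-1 : ℤ) * (WithZero.exp (1 : ℤ) * Valued.v y) ≤ WithZero.exp (-1 : ℤ) * 1 :=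
        mul_le_mul' le_rfl h
      rwa [← mul_assoc, ← WithZero.exp_add, show (-1 : ℤ) + 1 = 0 by norm_num, WithZero.exp_zero,
        one_mul, mul_one] at this
    · intro h
      calc WithZero.exp (1 : ℤ) * Valued.v y ≤ WithZero.exp (1 : ℤ) * WithZero.exp (-1 : ℤ) :=
            mul_le_mul' le_rfl h
        _ = 1 := by rw [← WithZero.exp_add]; norm_num
  -- entrywise integrality of a conjugate of an integral matrix with `|y₀₁| ≤ |p|`
  have hconj : ∀ Y : GL (Fin 2) (v.adicCompletion ℚ),
      (∀ i j, Valued.v ((Y : Matrix (Fin 2) (Fin 2) (v.adicCompletion ℚ)) i j) ≤ 1) →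
      Valued.v ((Y : Matrix (Fin 2) (Fin 2) (v.adicCompletion ℚ)) 0 1) ≤ WithZero.exp (-1 : ℤ) →
      ∀ i j, Valued.v ((((Rat.localHeckeDiag v)⁻¹ * Y * Rat.localHeckeDiag v :
        GL (Fin 2) (v.adicCompletion ℚ)) : Matrix (Fin 2) (Fin 2) (v.adicCompletion ℚ)) i j) ≤ 1 := by
    intro Y hY hY01 i j
    rw [Rat.coe_localHeckeDiag_inv_mul_mul]
    fin_cases i <;> fin_cases j
    · simp only [Fin.zero_eta, Matrix.cons_val_zero]
      rw [mul_comm _ ((Y : Matrix (Fin 2) (Fin 2) (v.adicCompletion ℚ)) 0 0), mul_assoc,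
        inv_mul_cancel₀ hp0, mul_one]
      exact hY 0 0
    · simp only [Fin.zero_eta, Fin.mk_one, Matrix.cons_val_zero, Matrix.cons_val_one,
        Matrix.cons_val_fin_one]
      exact (key _).2 hY01
    · simp only [Fin.mk_one, Fin.zero_eta, Matrix.cons_val_one, Matrix.cons_val_zero,
        Matrix.cons_val_fin_one, one_mul]
      rw [map_mul]
      exact mul_le_one' (hY 1 0) hp1
    · simp only [Fin.mk_one, Matrix.cons_val_one, Matrix.cons_val_fin_one, one_mul, mul_one]
      exact hY 1 1
  obtain ⟨h1, h2, -⟩ := mem_valuedCongruenceSubgroup_iff.1 hM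
  constructor
  · intro h
    have h01 := (mem_valuedCongruenceSubgroup_iff.1 h).1 0 1
    rw [Rat.coe_localHeckeDiag_inv_mul_mul] at h01
    simp only [Matrix.cons_val_zero, Matrix.cons_val_one, Matrix.cons_val_fin_one] at h01
    exact (key _).1 h01
  · intro h01
    have hinv01 : Valued.v (((M⁻¹ : GL (Fin 2) (v.adicCompletion ℚ)) :
        Matrix (Fin 2) (Fin 2) (v.adicCompletion ℚ)) 0 1) ≤ WithZero.exp (-1 : ℤ) :=
      (Rat.valued_inv_apply_zero_one_le hM).trans h01
    refine ⟨hconj M h1 h01, fun i j => ?_, fun i j => ?_⟩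
    · rw [_root_.mul_inv_rev, _root_.mul_inv_rev, inv_inv, ← mul_assoc]
      exact hconj M⁻¹ h2 hinv01 i j
    · rw [Matrix.sub_apply]
      refine (Valued.v.map_sub _ _).trans (max_le (hconj M h1 h01 i j) ?_)
      rw [Matrix.one_apply]
      split_ifs <;> simp

end HeckeElement


/-! ### The `p + 1` coset representatives at `v`: distinctness and exhaustion -/

section CosetReps

open Rat.HeightOneSpectrum EllipticCurves.ModularForms ModularGroup

/-- In `ℤᵐ⁰`, `x < 1 ↔ x ≤ exp(-1)`. [folklore] -/
theorem WithZero.lt_one_iff_le_exp_neg_one (x : WithZero (Multiplicative ℤ)) :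
    x < 1 ↔ x ≤ WithZero.exp (-1 : ℤ) := by
  cases x with
  | zero => simp
  | coe a =>
    change (WithZero.exp (Multiplicative.toAdd a) : WithZero (Multiplicative ℤ)) < 1 ↔
      WithZero.exp (Multiplicative.toAdd a) ≤ _
    rw [← WithZero.exp_zero, WithZero.exp_lt_exp, WithZero.exp_le_exp]
    omega

variable (X : SL(2, ℤ)) (p : ℕ)

/-- **Diamond–Shurman's representatives** `t_j = (1 j; 0 1) = T^j` (`j < p`, index `some j`) and
`t_∞ = X = (mp n; N 1)` (index `none`) of `Γ₃ \ Γ₁(N)`, `Γ₃ = Γ₁(N) ∩ diag(1,p)⁻¹Γ₁(N)diag(1,p)`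
(§5.2, p. 190; the convention `i.elim X (j ↦ T^j)` of `HeckeOperatorsGamma1QExpansionProofs`).
Their inverses times `t₀ = diag(p, 1)` localised at `p` are Gelbart's representatives
`(p -j; 0 1)`, `(1 0; 0 p)·GL₂(ℤ_p)` of `K_p diag(p,1) K_p / K_p` (Lemma 3.7). [cite: DiamondShurman2005, §5.2, p. 190] -/
def Rat.cosetRep (i : Option (Fin p)) : SL(2, ℤ) :=
  i.elim X fun j => T ^ ((j : ℕ) : ℤ)

variable {X p}

/-- `t_{some j} = T^j`. [folklore] -/
@[simp] theorem Rat.cosetRep_some (j : Fin p) : Rat.cosetRep X p (some j) = T ^ ((j : ℕ) : ℤ) := rfl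

/-- `t_none = X`. [folklore] -/
@[simp] theorem Rat.cosetRep_none : Rat.cosetRep X p none = X := rfl

/-- The representatives lie in `Γ₁(N)` (for `X` with bottom row `(N, 1)`). [cite: DiamondShurman2005, §5.2, p. 190] -/
theorem Rat.cosetRep_mem_gamma1 {N : ℕ} (hX10 : X 1 0 = N) (hX11 : X 1 1 = 1) (i : Option (Fin p)) :
    Rat.cosetRep X p i ∈ CongruenceSubgroup.Gamma1 N := by
  cases i with
  | none => exact HeckeTGamma1.mem_Gamma1_of_entries N hX10 hX11
  | some j => exact HeckeTGamma1.T_zpow_mem_Gamma1 N _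

variable {v : HeightOneSpectrum (𝓞 ℚ)} {N : ℕ}

/-- **Distinctness of the local cosets** (the `p`-adic form of Diamond–Shurman, Exercise 5.2.3):
if `D_v⁻¹ ι_v(t_i t_{i'}⁻¹) D_v ∈ GL₂(𝒪_v)` then `i = i'`. Indeed the `(0,1)` entry gives
`p ∣ (t_i t_{i'}⁻¹)₀₁`, so `diag(1,p) t_i t_{i'}⁻¹ diag(1,p)⁻¹ ∈ Γ₁(N)` (`conj_mul_inv_mem_iff`),
and the classes `Γ₃ t_i` are distinct (`existsUnique_option`). [cite: DiamondShurman2005, §5.2, pp. 190–191] -/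
theorem Rat.cosetRep_eq_of_conj_mem (hp : (natGenerator v).Prime) (hX10 : X 1 0 = N) (hX11 : X 1 1 = 1)
    (hX00 : (natGenerator v : ℤ) ∣ X 0 0) {i i' : Option (Fin (natGenerator v))}
    (h : (Rat.localHeckeDiag v)⁻¹ *
        Rat.globalToLocal 2 v (Matrix.SpecialLinearGroup.mapGL ℚ
          (Rat.cosetRep X _ i * (Rat.cosetRep X _ i')⁻¹)) * Rat.localHeckeDiag v ∈
      valuedCongruenceSubgroup (Fin 2) (1 : WithZero (Multiplicative ℤ))) :
    i = i' := by
  haveI : NeZero (natGenerator v) := ⟨hp.ne_zero⟩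
  set A := Rat.cosetRep X (natGenerator v) i with hA
  set B := Rat.cosetRep X (natGenerator v) i' with hB
  -- `p ∣ (t_i t_{i'}⁻¹)₀₁`
  have h01 := (Rat.localHeckeDiag_inv_mul_mul_mem_iff
    (Rat.globalToLocal_mapGL_mem_valuedCongruenceSubgroup_one (A * B⁻¹))).1 h
  rw [Rat.coe_globalToLocal_mapGL_apply, Rat.valued_intCast_le_exp_neg_one_iff] at h01
  -- the classical uniqueness
  have hAmem : A ∈ CongruenceSubgroup.Gamma1 N := Rat.cosetRep_mem_gamma1 hX10 hX11 i
  have hBmem : B ∈ CongruenceSubgroup.Gamma1 N := Rat.cosetRep_mem_gamma1 hX10 hX11 i'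
  obtain ⟨i₀, -, huniq⟩ := HeckeTGamma1.existsUnique_option N hp (HeckeTGamma1.val_G (natGenerator v))
    hX10 hX11 hX00 (Matrix.SpecialLinearGroup.mapGL ℝ A) ⟨A, hAmem, rfl⟩
  have hi : i = i₀ := huniq i (by
    change _ * _ * (Matrix.SpecialLinearGroup.mapGL ℝ A)⁻¹ * _ ∈ _
    rw [mul_inv_cancel_right, mul_inv_cancel]
    exact one_mem _)
  have hi' : i' = i₀ := huniq i' (by
    change _ * _ * (Matrix.SpecialLinearGroup.mapGL ℝ B)⁻¹ * _ ∈ _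
    exact (HeckeTGamma1.conj_mul_inv_mem_iff N (HeckeTGamma1.val_G (natGenerator v)) hAmem hBmem).2 h01)
  rw [hi, hi']

end CosetReps


section Exhaustion

open Rat.HeightOneSpectrum EllipticCurves.ModularForms ModularGroup

variable {X : SL(2, ℤ)} {v : HeightOneSpectrum (𝓞 ℚ)} {N : ℕ}

/-- The `(0,1)` entry of `ι_v(A) κ` for `A ∈ SL₂(ℤ)`: `a₀₀ κ₀₁ + a₀₁ κ₁₁`. [folklore] -/
theorem Rat.globalToLocal_mapGL_mul_apply_zero_one (A : SL(2, ℤ)) (κ : GL (Fin 2) (v.adicCompletion ℚ)) :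
    ((Rat.globalToLocal 2 v (Matrix.SpecialLinearGroup.mapGL ℚ A) * κ : GL (Fin 2) (v.adicCompletion ℚ)) :
      Matrix (Fin 2) (Fin 2) (v.adicCompletion ℚ)) 0 1 =
      (((A : Matrix (Fin 2) (Fin 2) ℤ) 0 0 : ℤ) : v.adicCompletion ℚ) *
          (κ : Matrix (Fin 2) (Fin 2) (v.adicCompletion ℚ)) 0 1 +
        (((A : Matrix (Fin 2) (Fin 2) ℤ) 0 1 : ℤ) : v.adicCompletion ℚ) *
          (κ : Matrix (Fin 2) (Fin 2) (v.adicCompletion ℚ)) 1 1 := by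
  rw [Units.val_mul, Matrix.mul_apply, Fin.sum_univ_two, Rat.coe_globalToLocal_mapGL_apply,
    Rat.coe_globalToLocal_mapGL_apply]

/-- **Exhaustion of `K_p diag(p,1) K_p` by the `p + 1` cosets** (the `p`-adic form of
Diamond–Shurman's case analysis, §5.2, pp. 190–191, Exercise 5.2.2; Gelbart (1975), proof of
Lemma 3.7: `H_p = ⊔_{b<p} (p -b; 0 1) K_p ⊔ (1 0; 0 p) K_p` "from the theory of elementary
divisors"): for every `κ ∈ GL₂(𝒪_v)` there is an index `i` with
`D_v⁻¹ ι_v(t_i) κ D_v ∈ GL₂(𝒪_v)` — `i = j` with `j ≡ -κ₀₁ κ₁₁⁻¹ (mod 𝓂_v)` if `κ₁₁` is a unit,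
`i = ∞` if `κ₁₁ ∈ 𝓂_v`. [cite: Gelbart1975, Lemma 3.7 (proof)] -/
theorem Rat.exists_conj_cosetRep_mul_mem (hp : (natGenerator v).Prime)
    (hX00 : (natGenerator v : ℤ) ∣ X 0 0) {κ : GL (Fin 2) (v.adicCompletion ℚ)}
    (hκ : κ ∈ valuedCongruenceSubgroup (Fin 2) (1 : WithZero (Multiplicative ℤ))) :
    ∃ i : Option (Fin (natGenerator v)),
      (Rat.localHeckeDiag v)⁻¹ *
          (Rat.globalToLocal 2 v (Matrix.SpecialLinearGroup.mapGL ℚ (Rat.cosetRep X _ i)) * κ) *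
        Rat.localHeckeDiag v ∈
      valuedCongruenceSubgroup (Fin 2) (1 : WithZero (Multiplicative ℤ)) := by
  haveI : NeZero (natGenerator v) := ⟨hp.ne_zero⟩
  set p := natGenerator v with hpdef
  have h1 := (mem_valuedCongruenceSubgroup_iff.1 hκ).1
  -- it suffices to make the `(0,1)` entry of `t_i κ` divisible by `p`
  suffices h : ∃ i : Option (Fin p), Valued.v
      (((Rat.globalToLocal 2 v (Matrix.SpecialLinearGroup.mapGL ℚ (Rat.cosetRep X p i)) * κ :
        GL (Fin 2) (v.adicCompletion ℚ)) : Matrix (Fin 2) (Fin 2) (v.adicCompletion ℚ)) 0 1) < 1 by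
    obtain ⟨i, hi⟩ := h
    refine ⟨i, (Rat.localHeckeDiag_inv_mul_mul_mem_iff (mul_mem
      (Rat.globalToLocal_mapGL_mem_valuedCongruenceSubgroup_one _) hκ)).2 ?_⟩
    exact (WithZero.lt_one_iff_le_exp_neg_one _).1 hi
  rcases (h1 1 1).lt_or_eq with h11 | h11
  · -- `κ₁₁ ∈ 𝓂_v`: the representative `X`, `p ∣ X₀₀`
    refine ⟨none, ?_⟩
    rw [Rat.globalToLocal_mapGL_mul_apply_zero_one, Rat.cosetRep_none]
    refine Valuation.map_add_lt _ ?_ ?_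
    · rw [map_mul]
      exact mul_lt_one_of_lt_of_le (Rat.valued_intCast_lt_one_of_dvd hX00) (h1 0 1)
    · rw [map_mul, mul_comm]
      exact mul_lt_one_of_lt_of_le h11 (Rat.valued_intCast_le_one _)
  · -- `κ₁₁ ∈ 𝒪_vˣ`: the representative `T^j`, `j ≡ -κ₀₁/κ₁₁`
    have hκ11 : (κ : Matrix (Fin 2) (Fin 2) (v.adicCompletion ℚ)) 1 1 ≠ 0 := by
      intro h0; rw [h0, map_zero] at h11; exact zero_ne_one h11
    set u : v.adicCompletion ℚ := (κ : Matrix (Fin 2) (Fin 2) (v.adicCompletion ℚ)) 0 1 *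
      ((κ : Matrix (Fin 2) (Fin 2) (v.adicCompletion ℚ)) 1 1)⁻¹ with hu
    have hu1 : Valued.v u ≤ 1 := by
      rw [hu, map_mul, map_inv₀, h11, inv_one, mul_one]; exact h1 0 1
    obtain ⟨m, hm⟩ := Rat.exists_int_valued_sub_lt_one hu1
    set j : Fin p := ⟨((-m : ℤ) : ZMod p).val, ZMod.val_lt _⟩ with hj
    have hjm : (p : ℤ) ∣ m + ((j : ℕ) : ℤ) := by
      rw [← ZMod.intCast_zmod_eq_zero_iff_dvd]
      push_cast
      rw [hj, ZMod.natCast_zmod_val]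
      push_cast
      ring
    refine ⟨some j, ?_⟩
    rw [Rat.globalToLocal_mapGL_mul_apply_zero_one, Rat.cosetRep_some, coe_T_zpow]
    simp only [Matrix.of_apply, Matrix.cons_val', Matrix.cons_val_zero, Matrix.cons_val_one,
      Matrix.empty_val', Matrix.cons_val_fin_one, Int.cast_one, one_mul]
    -- `κ₀₁ + j κ₁₁ = κ₁₁ ((u - m) + (m + j))`
    have key : (κ : Matrix (Fin 2) (Fin 2) (v.adicCompletion ℚ)) 0 1 +
        ((((j : ℕ) : ℤ) : ℤ) : v.adicCompletion ℚ) * (κ : Matrix (Fin 2) (Fin 2) (v.adicCompletion ℚ)) 1 1 =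
        (κ : Matrix (Fin 2) (Fin 2) (v.adicCompletion ℚ)) 1 1 *
          ((u - (m : v.adicCompletion ℚ)) + ((m + ((j : ℕ) : ℤ) : ℤ) : v.adicCompletion ℚ)) := by
      rw [hu]; push_cast; field_simp; ring
    rw [key, map_mul, h11, one_mul]
    exact Valuation.map_add_lt _ hm (Rat.valued_intCast_lt_one_of_dvd hjm)

end Exhaustion


section Transversal

open Rat.HeightOneSpectrum EllipticCurves.ModularForms ModularGroup

/-- `p_v ∣ N ↔ v ∣ (N)`. [folklore] -/
theorem Rat.natGenerator_dvd_iff (v : HeightOneSpectrum (𝓞 ℚ)) (N : ℕ) :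
    natGenerator v ∣ N ↔ v.asIdeal ∣ Ideal.span {(N : 𝓞 ℚ)} := by
  rw [Ideal.dvd_span_singleton, GaloisRepresentations.Rat.natCast_mem_asIdeal_iff]

/-- The archimedean part of a local element `ι_v(x)` is trivial. [folklore] -/
@[simp]
theorem GLn.fstHom_ofLocal {n : ℕ} {K : Type} [Field K] [NumberField K] (v : HeightOneSpectrum (𝓞 K))
    (x : GL (Fin n) (v.adicCompletion K)) : GLn.fstHom n K (GLn.ofLocal n K v x) = 1 :=
  Matrix.GeneralLinearGroup.ext fun i j => GLn.fst_coe_ofLocal_apply x i j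

/-- The archimedean part (as a real matrix) of a local element `ι_v(x)` is trivial. [folklore] -/
@[simp]
theorem Rat.archGL_ofLocal {n : ℕ} (v : HeightOneSpectrum (𝓞 ℚ)) (x : GL (Fin n) (v.adicCompletion ℚ)) :
    Rat.archGL n (GLn.ofLocal n ℚ v x) = 1 := by
  rw [Rat.archGL, MonoidHom.comp_apply, GLn.fstHom_ofLocal, map_one]

variable (v : HeightOneSpectrum (𝓞 ℚ)) (X : SL(2, ℤ))

/-- **The adelic transversal** `y_i = ι_v(t_i⁻¹ diag(p,1))`, `i ∈ {0,…,p-1,∞}`, of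
`K(N) t_{v,1} K(N) / K(N)`: at `p` these are Gelbart's `(p -j; 0 1)` (`i = j`) and an element of
`(1 0; 0 p) GL₂(ℤ_p)` (`i = ∞`), at all other places the identity (Gelbart (1975), proof of
Lemma 3.7; Bump (1997), (6.7): `K_p diag(ϖ_p,1) K_p = ⊔ i_p(ξ_i) K_p`). [cite: Gelbart1975, Lemma 3.7 (proof)] -/
def Rat.heckeTransversal (i : Option (Fin (natGenerator v))) : GL (Fin 2) (AdeleRing (𝓞 ℚ) ℚ) :=
  GLn.ofLocal 2 ℚ v (Rat.globalToLocal 2 v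
    (Matrix.SpecialLinearGroup.mapGL ℚ (Rat.cosetRep X _ i)⁻¹) * Rat.localHeckeDiag v)

variable {v X}

/-- The local component at `v` of `y_i` is `ι_v(t_i)⁻¹ D_v`. [folklore] -/
@[simp]
theorem Rat.localPart_heckeTransversal (i : Option (Fin (natGenerator v))) :
    GLn.localPart 2 ℚ v (Rat.heckeTransversal v X i) =
      (Rat.globalToLocal 2 v (Matrix.SpecialLinearGroup.mapGL ℚ (Rat.cosetRep X _ i)))⁻¹ *
        Rat.localHeckeDiag v := by
  rw [Rat.heckeTransversal, GLn.localPart_ofLocal, map_inv, map_inv]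

/-- The local components of `y_i` away from `v` are trivial. [folklore] -/
theorem Rat.localPart_heckeTransversal_of_ne {w : HeightOneSpectrum (𝓞 ℚ)} (hw : w ≠ v)
    (i : Option (Fin (natGenerator v))) :
    GLn.localPart 2 ℚ w (Rat.heckeTransversal v X i) = 1 :=
  GLn.localPart_ofLocal_of_ne hw _

/-- The archimedean part of `y_i` is trivial. [folklore] -/
@[simp]
theorem Rat.fstHom_heckeTransversal (i : Option (Fin (natGenerator v))) :
    GLn.fstHom 2 ℚ (Rat.heckeTransversal v X i) = 1 :=
  GLn.fstHom_ofLocal v _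

/-- **Distinctness**: `y_i⁻¹ y_{i'}` has local component `D_v⁻¹ ι_v(t_i t_{i'}⁻¹) D_v` at `v`, so
`y_i K(N) = y_{i'} K(N)` forces `i = i'`. [cite: DiamondShurman2005, §5.2, pp. 190–191] -/
theorem Rat.heckeTransversal_injective_mk {N : ℕ} (hX10 : X 1 0 = N) (hX11 : X 1 1 = 1)
    (hX00 : (natGenerator v : ℤ) ∣ X 0 0) {i i' : Option (Fin (natGenerator v))}
    (h : (Rat.heckeTransversal v X i)⁻¹ * Rat.heckeTransversal v X i' ∈
      principalCongruenceLevel 2 ℚ (Ideal.span {(N : 𝓞 ℚ)})) : i = i' := by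
  have hloc := ((mem_principalCongruenceLevel_iff_forall_toLocal.1 h).2 v)
  have e : GLn.localPart 2 ℚ v ((Rat.heckeTransversal v X i)⁻¹ * Rat.heckeTransversal v X i') =
      (Rat.localHeckeDiag v)⁻¹ *
        Rat.globalToLocal 2 v (Matrix.SpecialLinearGroup.mapGL ℚ
          (Rat.cosetRep X _ i * (Rat.cosetRep X _ i')⁻¹)) * Rat.localHeckeDiag v := by
    rw [map_mul, map_inv, Rat.localPart_heckeTransversal, Rat.localPart_heckeTransversal,
      map_mul (Matrix.SpecialLinearGroup.mapGL ℚ), map_inv (Matrix.SpecialLinearGroup.mapGL ℚ),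
      map_mul (Rat.globalToLocal 2 v), map_inv (Rat.globalToLocal 2 v)]
    group
  rw [e] at hloc
  exact Rat.cosetRep_eq_of_conj_mem (prime_natGenerator v) hX10 hX11 hX00
    (valuedCongruenceSubgroup_mono (Fin 2) (idealRadius_le_one' v _) hloc)

end Transversal


section Transversal2

open Rat.HeightOneSpectrum EllipticCurves.ModularForms ModularGroup

variable {v : HeightOneSpectrum (𝓞 ℚ)} {X : SL(2, ℤ)} {N : ℕ}

/-- Local integral matrices give elements of `K(𝔫)` at a place `v ∤ 𝔫` (`isMaximalAt`). [folklore] -/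
theorem Rat.ofLocal_mem_principalCongruenceLevel {𝔫 : Ideal (𝓞 ℚ)} (h𝔫 : 𝔫 ≠ 0) (hv : ¬ v.asIdeal ∣ 𝔫)
    {x : GL (Fin 2) (v.adicCompletion ℚ)}
    (hx : x ∈ valuedCongruenceSubgroup (Fin 2) (1 : WithZero (Multiplicative ℤ))) :
    GLn.ofLocal 2 ℚ v x ∈ principalCongruenceLevel 2 ℚ 𝔫 :=
  isMaximalAt_principalCongruenceLevel 2 ℚ v h𝔫 hv ⟨x, hx, rfl⟩

/-- **`y_∞` lies in the double coset**: `X⁻¹ diag(p,1) = S diag(p,1) S⁻¹ C` in `GL₂(ℚ)` with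
`S = (0 -1; 1 0)`, `C = (p, -x₀₁; -N, m') ∈ SL₂(ℤ)` (`S diag(p,1) S⁻¹ = diag(1,p)`; Gelbart
(1975), §3.B: `w diag(p,1) w⁻¹ = diag(1,p)`, `w ∈ K_p`). [cite: Gelbart1975, §3.B] -/
theorem Rat.mapGL_inv_mul_diagPrime_eq (hX10 : X 1 0 = N) (hX11 : X 1 1 = 1) {m' : ℤ}
    (hm : X 0 0 = natGenerator v * m') :
    ∃ C : SL(2, ℤ), Matrix.SpecialLinearGroup.mapGL ℚ X⁻¹ * Rat.diagPrime v =
      Matrix.SpecialLinearGroup.mapGL ℚ S * Rat.diagPrime v * Matrix.SpecialLinearGroup.mapGL ℚ (S⁻¹ * C) := by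
  have hXdet : X 0 0 * X 1 1 - X 0 1 * X 1 0 = 1 := by
    have := X.2; rwa [Matrix.det_fin_two] at this
  have hCdet : !![(natGenerator v : ℤ), -X 0 1; -X 1 0, m'].det = 1 := by
    rw [Matrix.det_fin_two_of]
    rw [hm, hX11] at hXdet
    linear_combination hXdet
  refine ⟨⟨_, hCdet⟩, ?_⟩
  refine Matrix.GeneralLinearGroup.ext fun i j => ?_
  have hentry : ∀ (B : SL(2, ℤ)) i j,
      ((Matrix.SpecialLinearGroup.mapGL ℚ B : GL (Fin 2) ℚ) : Matrix (Fin 2) (Fin 2) ℚ) i j =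
        ((B : Matrix (Fin 2) (Fin 2) ℤ) i j : ℚ) := fun B i j => rfl
  simp only [Units.val_mul, Matrix.mul_apply, Fin.sum_univ_two, hentry, Rat.coe_diagPrime,
    Matrix.SpecialLinearGroup.coe_mul, Matrix.SpecialLinearGroup.coe_inv, coe_S,
    Matrix.adjugate_fin_two]
  have h00 : ((X 0 0 : ℤ) : ℚ) = (natGenerator v : ℚ) * m' := by exact_mod_cast hm
  have h10 : ((X 1 0 : ℤ) : ℚ) = N := by exact_mod_cast hX10
  have h11 : ((X 1 1 : ℤ) : ℚ) = 1 := by exact_mod_cast hX11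
  fin_cases i <;> fin_cases j <;> simp [h00, h10, h11, mul_comm]

end Transversal2


section Transversal3

open Rat.HeightOneSpectrum EllipticCurves.ModularForms ModularGroup

variable {v : HeightOneSpectrum (𝓞 ℚ)} {X : SL(2, ℤ)} {N : ℕ}

/-- The level ideal `(N) ≠ 0` for `N ≠ 0` (as `Rat.span_natCast_ne_zero N`, not imported here). [folklore] -/
theorem Rat.span_natCast_ne_zero (N : ℕ) [NeZero N] : (Ideal.span {(N : 𝓞 ℚ)} : Ideal (𝓞 ℚ)) ≠ 0 := by
  rw [Ne, Ideal.zero_eq_bot, Ideal.span_singleton_eq_bot]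
  exact_mod_cast NeZero.ne N

/-- **Each `y_i` lies in the double coset `K(N) t_{v,1} K(N)`**: `y_j = ι_v(T^{-j}) t_{v,1}` and
`y_∞ = ι_v(S) t_{v,1} ι_v(S⁻¹ C)` with `ι_v(T^{-j}), ι_v(S), ι_v(S⁻¹C) ∈ K(N)` (integral at `v`,
identity elsewhere). [cite: Gelbart1975, Lemma 3.7 (proof)] -/
theorem Rat.mk_heckeTransversal_mem_orbit [NeZero N] (hv : ¬ v.asIdeal ∣ Ideal.span {(N : 𝓞 ℚ)})
    (hX10 : X 1 0 = N) (hX11 : X 1 1 = 1) (hX00 : (natGenerator v : ℤ) ∣ X 0 0)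
    (i : Option (Fin (natGenerator v))) :
    (Rat.heckeTransversal v X i : GL (Fin 2) (AdeleRing (𝓞 ℚ) ℚ) ⧸
        principalCongruenceLevel 2 ℚ (Ideal.span {(N : 𝓞 ℚ)})) ∈
      MulAction.orbit (principalCongruenceLevel 2 ℚ (Ideal.span {(N : 𝓞 ℚ)}))
        (heckeDiagAt 2 ℚ v (Rat.localUniformizer v) 1 : GL (Fin 2) (AdeleRing (𝓞 ℚ) ℚ) ⧸
          principalCongruenceLevel 2 ℚ (Ideal.span {(N : 𝓞 ℚ)})) := by
  have h𝔫 : Ideal.span {(N : 𝓞 ℚ)} ≠ 0 := Rat.span_natCast_ne_zero N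
  rw [Rat.heckeDiagAt_localUniformizer_one, MulAction.mem_orbit_iff]
  cases i with
  | some j =>
    set k := GLn.ofLocal 2 ℚ v (Rat.globalToLocal 2 v
      (Matrix.SpecialLinearGroup.mapGL ℚ (T ^ ((j : ℕ) : ℤ))⁻¹)) with hkdef
    refine ⟨⟨k, Rat.ofLocal_mem_principalCongruenceLevel h𝔫 hv
        (Rat.globalToLocal_mapGL_mem_valuedCongruenceSubgroup_one _)⟩, ?_⟩
    show (QuotientGroup.mk (k * GLn.ofLocal 2 ℚ v (Rat.localHeckeDiag v)) :
      GL (Fin 2) (AdeleRing (𝓞 ℚ) ℚ) ⧸ principalCongruenceLevel 2 ℚ (Ideal.span {(N : 𝓞 ℚ)})) = _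
    rw [hkdef, ← map_mul, Rat.heckeTransversal, Rat.cosetRep_some, map_inv]
  | none =>
    obtain ⟨m', hm⟩ := hX00
    obtain ⟨C, hC⟩ := Rat.mapGL_inv_mul_diagPrime_eq (v := v) hX10 hX11 hm
    set k := GLn.ofLocal 2 ℚ v (Rat.globalToLocal 2 v (Matrix.SpecialLinearGroup.mapGL ℚ S)) with hkdef
    refine ⟨⟨k, Rat.ofLocal_mem_principalCongruenceLevel h𝔫 hv
        (Rat.globalToLocal_mapGL_mem_valuedCongruenceSubgroup_one _)⟩, ?_⟩
    show (QuotientGroup.mk (k * GLn.ofLocal 2 ℚ v (Rat.localHeckeDiag v)) :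
      GL (Fin 2) (AdeleRing (𝓞 ℚ) ℚ) ⧸ principalCongruenceLevel 2 ℚ (Ideal.span {(N : 𝓞 ℚ)})) = _
    rw [hkdef, Rat.heckeTransversal, Rat.cosetRep_none, ← Rat.globalToLocal_diagPrime,
      ← map_mul (Rat.globalToLocal 2 v) (Matrix.SpecialLinearGroup.mapGL ℚ X⁻¹), hC,
      map_mul (Rat.globalToLocal 2 v), map_mul (Rat.globalToLocal 2 v),
      map_mul (GLn.ofLocal 2 ℚ v), map_mul (GLn.ofLocal 2 ℚ v)]
    apply QuotientGroup.eq.2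
    rw [inv_mul_cancel_left]
    exact Rat.ofLocal_mem_principalCongruenceLevel h𝔫 hv
      (Rat.globalToLocal_mapGL_mem_valuedCongruenceSubgroup_one _)

/-- **Exhaustion**: every left coset in `K(N) t_{v,1} K(N)` is some `y_i K(N)` — for `k ∈ K(N)`
the element `y_i⁻¹ k t_{v,1}` is `k_w ∈ K(N)_w` away from `v` and `D_v⁻¹ ι_v(t_i) k_v D_v` at `v`,
which is integral for the index `i` of `Rat.exists_conj_cosetRep_mul_mem`. [cite: Gelbart1975, Lemma 3.7 (proof)] -/
theorem Rat.exists_mk_heckeTransversal_eq [NeZero N] (hv : ¬ v.asIdeal ∣ Ideal.span {(N : 𝓞 ℚ)})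
    (hX00 : (natGenerator v : ℤ) ∣ X 0 0)
    {k : GL (Fin 2) (AdeleRing (𝓞 ℚ) ℚ)} (hk : k ∈ principalCongruenceLevel 2 ℚ (Ideal.span {(N : 𝓞 ℚ)})) :
    ∃ i : Option (Fin (natGenerator v)),
      (Rat.heckeTransversal v X i : GL (Fin 2) (AdeleRing (𝓞 ℚ) ℚ) ⧸
          principalCongruenceLevel 2 ℚ (Ideal.span {(N : 𝓞 ℚ)})) =
        (k * heckeDiagAt 2 ℚ v (Rat.localUniformizer v) 1 : GL (Fin 2) (AdeleRing (𝓞 ℚ) ℚ) ⧸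
          principalCongruenceLevel 2 ℚ (Ideal.span {(N : 𝓞 ℚ)})) := by
  have h𝔫 : Ideal.span {(N : 𝓞 ℚ)} ≠ 0 := Rat.span_natCast_ne_zero N
  have hrad : idealRadius ℚ v (Ideal.span {(N : 𝓞 ℚ)}) = 1 := idealRadius_eq_one_of_not_dvd h𝔫 hv
  obtain ⟨hk1, hk2⟩ := mem_principalCongruenceLevel_iff_forall_toLocal.1 hk
  have hkv : GLn.localPart 2 ℚ v k ∈ valuedCongruenceSubgroup (Fin 2) (1 : WithZero (Multiplicative ℤ)) := by
    rw [← hrad]; exact hk2 v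
  obtain ⟨i, hi⟩ := Rat.exists_conj_cosetRep_mul_mem (X := X) (prime_natGenerator v) hX00 hkv
  refine ⟨i, QuotientGroup.eq.2 ?_⟩
  rw [mem_principalCongruenceLevel_iff_forall_toLocal]
  refine ⟨by rw [map_mul, map_mul, map_inv, Rat.fstHom_heckeTransversal, hk1,
    Rat.heckeDiagAt_localUniformizer_one, GLn.fstHom_ofLocal, inv_one, one_mul, one_mul], fun w => ?_⟩
  by_cases hw : w = v
  · subst hw
    rw [hrad, map_mul, map_mul, map_inv, Rat.localPart_heckeTransversal,
      Rat.heckeDiagAt_localUniformizer_one, GLn.localPart_ofLocal, _root_.mul_inv_rev, inv_inv]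
    simpa only [mul_assoc] using hi
  · rw [map_mul, map_mul, map_inv, Rat.localPart_heckeTransversal_of_ne hw,
      Rat.heckeDiagAt_localUniformizer_one, GLn.localPart_ofLocal_of_ne hw, inv_one, one_mul, mul_one]
    exact hk2 w

/-- **The double coset `K(N) t_{v,1} K(N)` is the disjoint union of the `p + 1` left cosets
`y_i K(N)`** (Gelbart (1975), proof of Lemma 3.7: `H_p = ⊔_{b<p} (p -b; 0 1) K_p ⊔ (1 0; 0 p) K_p`;
Bump (1997), (6.7)), in the form consumed by `heckeOperator_apply_eq_sum`: `x ↦ x K(N)` is a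
bijection from `{y_i}` onto the `K(N)`-orbit of `t_{v,1} K(N)` in `GL₂(𝔸_ℚ) ⧸ K(N)`. [cite: Gelbart1975, Lemma 3.7 (proof)] [cite: Bump1997, (6.7)] -/
theorem Rat.bijOn_heckeTransversal [DecidableEq (GL (Fin 2) (AdeleRing (𝓞 ℚ) ℚ))] [NeZero N] (hv : ¬ v.asIdeal ∣ Ideal.span {(N : 𝓞 ℚ)})
    (hX10 : X 1 0 = N) (hX11 : X 1 1 = 1) (hX00 : (natGenerator v : ℤ) ∣ X 0 0) :
    Set.BijOn (fun x : GL (Fin 2) (AdeleRing (𝓞 ℚ) ℚ) =>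
        (x : GL (Fin 2) (AdeleRing (𝓞 ℚ) ℚ) ⧸ principalCongruenceLevel 2 ℚ (Ideal.span {(N : 𝓞 ℚ)})))
      (Finset.univ.image (Rat.heckeTransversal v X) : Finset (GL (Fin 2) (AdeleRing (𝓞 ℚ) ℚ)))
      (MulAction.orbit (principalCongruenceLevel 2 ℚ (Ideal.span {(N : 𝓞 ℚ)}))
        (heckeDiagAt 2 ℚ v (Rat.localUniformizer v) 1 : GL (Fin 2) (AdeleRing (𝓞 ℚ) ℚ) ⧸
          principalCongruenceLevel 2 ℚ (Ideal.span {(N : 𝓞 ℚ)}))) := by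
  refine ⟨?_, ?_, ?_⟩
  · intro x hx
    obtain ⟨i, -, rfl⟩ := Finset.mem_image.1 hx
    exact Rat.mk_heckeTransversal_mem_orbit hv hX10 hX11 hX00 i
  · intro x hx x' hx' h
    obtain ⟨i, -, rfl⟩ := Finset.mem_image.1 hx
    obtain ⟨i', -, rfl⟩ := Finset.mem_image.1 hx'
    rw [Rat.heckeTransversal_injective_mk hX10 hX11 hX00 (QuotientGroup.eq.1 h)]
  · intro z hz
    obtain ⟨⟨k, hk⟩, rfl⟩ := MulAction.mem_orbit_iff.1 hz
    obtain ⟨i, hi⟩ := Rat.exists_mk_heckeTransversal_eq (X := X) hv hX00 hk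
    exact ⟨Rat.heckeTransversal v X i, Finset.mem_image.2 ⟨i, Finset.mem_univ _, rfl⟩, hi⟩

/-- The map `i ↦ y_i` is injective (distinct cosets). [folklore] -/
theorem Rat.heckeTransversal_injective (hX10 : X 1 0 = N) (hX11 : X 1 1 = 1)
    (hX00 : (natGenerator v : ℤ) ∣ X 0 0) : Function.Injective (Rat.heckeTransversal v X) := by
  intro i i' h
  refine Rat.heckeTransversal_injective_mk (N := N) hX10 hX11 hX00 ?_
  rw [h, inv_mul_cancel]
  exact one_mem _

/-- **The permutation of the cosets induced by an integral local matrix** (Bump (1997), p. 342: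
"there exist `j` and `k₀' ∈ K₀(N)` such that `k₀ i_p(ξ_i) = i_p(ξ_j) k₀'`"): for `h ∈ GL₂(𝒪_v)`
there is a permutation `σ` of the indices with `D_v⁻¹ ι_v(t_{σ i}) h ι_v(t_i)⁻¹ D_v ∈ GL₂(𝒪_v)`
for all `i` — existence by exhaustion, injectivity (hence bijectivity, the index set being
finite) by distinctness. [cite: Bump1997, §3.6, p. 342] -/
theorem Rat.exists_perm_conj_mem (hX10 : X 1 0 = N) (hX11 : X 1 1 = 1)
    (hX00 : (natGenerator v : ℤ) ∣ X 0 0) {h : GL (Fin 2) (v.adicCompletion ℚ)}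
    (hh : h ∈ valuedCongruenceSubgroup (Fin 2) (1 : WithZero (Multiplicative ℤ))) :
    ∃ σ : Option (Fin (natGenerator v)) ≃ Option (Fin (natGenerator v)), ∀ i,
      (Rat.localHeckeDiag v)⁻¹ *
          (Rat.globalToLocal 2 v (Matrix.SpecialLinearGroup.mapGL ℚ (Rat.cosetRep X _ (σ i))) *
            (h * (Rat.globalToLocal 2 v (Matrix.SpecialLinearGroup.mapGL ℚ (Rat.cosetRep X _ i)))⁻¹)) *
        Rat.localHeckeDiag v ∈
      valuedCongruenceSubgroup (Fin 2) (1 : WithZero (Multiplicative ℤ)) := by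
  have hκ : ∀ i : Option (Fin (natGenerator v)),
      h * (Rat.globalToLocal 2 v (Matrix.SpecialLinearGroup.mapGL ℚ (Rat.cosetRep X _ i)))⁻¹ ∈
        valuedCongruenceSubgroup (Fin 2) (1 : WithZero (Multiplicative ℤ)) := fun i =>
    mul_mem hh (inv_mem (Rat.globalToLocal_mapGL_mem_valuedCongruenceSubgroup_one _))
  choose f hf using fun i => Rat.exists_conj_cosetRep_mul_mem (X := X) (prime_natGenerator v) hX00 (hκ i)
  have hinj : Function.Injective f := by
    intro i i' hii'
    have hi := hf i
    have hi' := hf i'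
    rw [← hii'] at hi'
    have hmem := mul_mem (inv_mem hi) hi'
    have e : ((Rat.localHeckeDiag v)⁻¹ *
        (Rat.globalToLocal 2 v (Matrix.SpecialLinearGroup.mapGL ℚ (Rat.cosetRep X _ (f i))) *
          (h * (Rat.globalToLocal 2 v (Matrix.SpecialLinearGroup.mapGL ℚ (Rat.cosetRep X _ i)))⁻¹)) *
        Rat.localHeckeDiag v)⁻¹ *
        ((Rat.localHeckeDiag v)⁻¹ *
        (Rat.globalToLocal 2 v (Matrix.SpecialLinearGroup.mapGL ℚ (Rat.cosetRep X _ (f i))) *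
          (h * (Rat.globalToLocal 2 v (Matrix.SpecialLinearGroup.mapGL ℚ (Rat.cosetRep X _ i')))⁻¹)) *
        Rat.localHeckeDiag v) =
        (Rat.localHeckeDiag v)⁻¹ *
          Rat.globalToLocal 2 v (Matrix.SpecialLinearGroup.mapGL ℚ
            (Rat.cosetRep X _ i * (Rat.cosetRep X _ i')⁻¹)) * Rat.localHeckeDiag v := by
      rw [map_mul (Matrix.SpecialLinearGroup.mapGL ℚ), map_inv (Matrix.SpecialLinearGroup.mapGL ℚ),
        map_mul (Rat.globalToLocal 2 v), map_inv (Rat.globalToLocal 2 v)]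
      group
    rw [e] at hmem
    exact Rat.cosetRep_eq_of_conj_mem (prime_natGenerator v) hX10 hX11 hX00 hmem
  exact ⟨Equiv.ofBijective f (Finite.injective_iff_bijective.1 hinj), fun i => hf i⟩

end Transversal3


/-! ### Rational matrices in the local levels away from `p` -/

section AwayFromP

open Rat.HeightOneSpectrum EllipticCurves.ModularForms

variable {v w : HeightOneSpectrum (𝓞 ℚ)}

/-- `p_v` is a `w`-adic unit for `w ≠ v`. [folklore] -/
theorem Rat.valued_natGenerator_of_ne (hw : w ≠ v) :
    Valued.v ((natGenerator v : ℕ) : w.adicCompletion ℚ) = 1 := by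
  rw [← map_natCast (algebraMap ℚ (w.adicCompletion ℚ)), Literature.NumberTheory.GaloisRepresentations.valued_algebraMap_adicCompletion]
  exact Rat.valuation_natGenerator_of_ne hw

/-- Entries of the localisation of a rational matrix. [folklore] -/
theorem Rat.coe_globalToLocal_apply {n : ℕ} (γ : GL (Fin n) ℚ) (i j : Fin n) :
    (Rat.globalToLocal n w γ : Matrix (Fin n) (Fin n) (w.adicCompletion ℚ)) i j =
      algebraMap ℚ (w.adicCompletion ℚ) ((γ : Matrix (Fin n) (Fin n) ℚ) i j) := rfl

/-- **`diag(p,1)` lies in `K₁(𝔫)_w` for every `w ≠ v`** (`p = p_v` is a `w`-unit; the lower row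
of `diag(p,1)` is `(0, 1)`). [folklore] -/
theorem Rat.globalToLocal_diagPrime_mem_localGammaOne (hw : w ≠ v) (𝔫 : Ideal (𝓞 ℚ)) :
    Rat.globalToLocal 2 w (Rat.diagPrime v) ∈ Rat.localGammaOne w 𝔫 := by
  have hp := Rat.valued_natGenerator_of_ne hw
  have hp' : Valued.v (algebraMap ℚ (w.adicCompletion ℚ) (natGenerator v : ℚ)) = 1 := by
    rwa [map_natCast]
  have hinv : ((Rat.diagPrime v)⁻¹ : GL (Fin 2) ℚ) = (Literature.NumberTheory.EllipticCurves.ModularForms.diagGL (natGenerator v : ℚ)⁻¹ 1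
      (inv_pos.2 (Nat.cast_pos.2 (prime_natGenerator v).pos)) one_pos : GL(2, ℚ)⁺) := by
    refine inv_eq_of_mul_eq_one_right (Matrix.GeneralLinearGroup.ext fun i j => ?_)
    rw [Units.val_mul, Rat.coe_diagPrime, Literature.NumberTheory.EllipticCurves.ModularForms.coe_coe_diagGL]
    have hp0 : (natGenerator v : ℚ) ≠ 0 := by exact_mod_cast (prime_natGenerator v).ne_zero
    fin_cases i <;> fin_cases j <;> simp [Matrix.mul_apply, hp0]
  rw [Rat.mem_localGammaOne_iff]
  refine ⟨fun i j => ?_, fun i j => ?_, ?_, ?_⟩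
  · rw [Rat.coe_globalToLocal_apply, Rat.coe_diagPrime]
    fin_cases i <;> fin_cases j <;> simp [hp]
  · rw [← map_inv, hinv, Rat.coe_globalToLocal_apply, Literature.NumberTheory.EllipticCurves.ModularForms.coe_coe_diagGL]
    fin_cases i <;> fin_cases j <;> simp [map_inv₀, hp]
  · rw [Rat.coe_globalToLocal_apply, Rat.coe_diagPrime]
    simp
  · rw [Rat.coe_globalToLocal_apply, Rat.coe_diagPrime]
    simp

/-- The rational scalar matrix **`p_v · 1 ∈ GL₂(ℚ)`**, whose localisation at `v` gives the
central Hecke element `t_{v,2} = diag(ϖ_v, ϖ_v)` (Bump (1997), p. 341: `ℝ_p`). [folklore] -/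
def Rat.scalarPrime (v : HeightOneSpectrum (𝓞 ℚ)) : GL (Fin 2) ℚ :=
  glDiagonal 2 ℚ fun _ => Units.mk0 (natGenerator v : ℚ) (by exact_mod_cast (prime_natGenerator v).ne_zero)

/-- The matrix of `p_v · 1`. [folklore] -/
@[simp]
theorem Rat.coe_scalarPrime (v : HeightOneSpectrum (𝓞 ℚ)) :
    (Rat.scalarPrime v : Matrix (Fin 2) (Fin 2) ℚ) = (natGenerator v : ℚ) • (1 : Matrix (Fin 2) (Fin 2) ℚ) := by
  rw [Rat.scalarPrime, coe_glDiagonal, Matrix.smul_one_eq_diagonal]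
  rfl

/-- **`t_{v,2}(ϖ_v) = ι_v(p_v · 1)`.** [folklore] -/
theorem Rat.heckeDiagAt_localUniformizer_two (v : HeightOneSpectrum (𝓞 ℚ)) :
    heckeDiagAt 2 ℚ v (Rat.localUniformizer v) 2 =
      GLn.ofLocal 2 ℚ v (Rat.globalToLocal 2 v (Rat.scalarPrime v)) := by
  rw [heckeDiagAt_eq_ofLocal_glDiagonal]
  congr 1
  refine Matrix.GeneralLinearGroup.ext fun i j => ?_
  rw [coe_glDiagonal, Rat.coe_globalToLocal_apply, Rat.coe_scalarPrime]
  fin_cases i <;> fin_cases j <;> simp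

/-- `p_v · 1` is central: `ι_w(p·1)⁻¹ h ι_w(p·1) = h` in `GL₂(ℚ_w)`. [folklore] -/
theorem Rat.globalToLocal_scalarPrime_inv_mul_mul (h : GL (Fin 2) (w.adicCompletion ℚ)) :
    (Rat.globalToLocal 2 w (Rat.scalarPrime v))⁻¹ * h * Rat.globalToLocal 2 w (Rat.scalarPrime v) = h := by
  have hc : Rat.globalToLocal 2 w (Rat.scalarPrime v) ∈ Subgroup.center (GL (Fin 2) (w.adicCompletion ℚ)) := by
    rw [Subgroup.mem_center_iff]
    intro g
    refine Matrix.GeneralLinearGroup.ext fun i j => ?_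
    have hval : (Rat.globalToLocal 2 w (Rat.scalarPrime v) : Matrix (Fin 2) (Fin 2) (w.adicCompletion ℚ)) =
        (algebraMap ℚ (w.adicCompletion ℚ) (natGenerator v : ℚ)) • (1 : Matrix (Fin 2) (Fin 2) (w.adicCompletion ℚ)) := by
      ext a b
      rw [Rat.coe_globalToLocal_apply, Rat.coe_scalarPrime, Matrix.smul_apply, Matrix.smul_apply,
        Matrix.one_apply, Matrix.one_apply, smul_eq_mul, smul_eq_mul, mul_ite, mul_one, mul_zero]
      split_ifs <;> simp
    rw [Units.val_mul, Units.val_mul, hval, Matrix.mul_smul, Matrix.mul_one, Matrix.smul_mul, Matrix.one_mul]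
  rw [mul_assoc, Subgroup.mem_center_iff.1 hc h, inv_mul_cancel_left]

/-- **`p⁻¹ γ₁ ∈ K₁(N)_w` away from `p`** for `γ₁ ∈ Γ₀(N)` with lower-right entry `≡ p (mod N)`:
the entries `a/p, b/p, c/p, d/p` and those of the inverse `p γ₁⁻¹` are `w`-integral (`p` is a
`w`-unit), `N ∣ c` and `N ∣ d - p` (Gelbart (1975), (3.3)–(3.5): the bookkeeping of the central
character at the places `q ∣ N`). [cite: Gelbart1975, (3.5)] -/
theorem Rat.globalToLocal_mapGL_mul_scalarPrime_inv_mem_localGammaOne {N : ℕ} [NeZero N] (hw : w ≠ v)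
    (γ : CongruenceSubgroup.Gamma0 N)
    (hγ : CongruenceSubgroup.Gamma0Map N γ = ((natGenerator v : ℕ) : ZMod N)) :
    Rat.globalToLocal 2 w (Matrix.SpecialLinearGroup.mapGL ℚ (γ : SL(2, ℤ)) * (Rat.scalarPrime v)⁻¹) ∈
      Rat.localGammaOne w (Ideal.span {(N : 𝓞 ℚ)}) := by
  have hN : N ≠ 0 := NeZero.ne N
  set p := natGenerator v with hpdef
  have hp0 : (p : ℚ) ≠ 0 := by exact_mod_cast (prime_natGenerator v).ne_zero
  have hpw : Valued.v (algebraMap ℚ (w.adicCompletion ℚ) (p : ℚ)) = 1 := by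
    rw [map_natCast]; exact Rat.valued_natGenerator_of_ne hw
  have hval : ∀ q : ℚ, Valued.v (algebraMap ℚ (w.adicCompletion ℚ) q) = w.valuation ℚ q :=
    fun q => Literature.NumberTheory.GaloisRepresentations.valued_algebraMap_adicCompletion w q
  -- matrices of `γ p⁻¹` and of its inverse `p γ⁻¹`
  set A : Matrix (Fin 2) (Fin 2) ℤ := ((γ : SL(2, ℤ)) : Matrix (Fin 2) (Fin 2) ℤ) with hA
  have hM : ((Matrix.SpecialLinearGroup.mapGL ℚ (γ : SL(2, ℤ)) * (Rat.scalarPrime v)⁻¹ : GL (Fin 2) ℚ) :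
      Matrix (Fin 2) (Fin 2) ℚ) = (p : ℚ)⁻¹ • A.map (Int.castRingHom ℚ) := by
    have h1 : ((Rat.scalarPrime v)⁻¹ : GL (Fin 2) ℚ) = glDiagonal 2 ℚ fun _ => (Units.mk0 (p : ℚ) hp0)⁻¹ := by
      rw [Rat.scalarPrime, ← map_inv]; rfl
    rw [Units.val_mul, h1, coe_glDiagonal]
    ext i j
    rw [Matrix.mul_apply, Fin.sum_univ_two, Matrix.smul_apply, Matrix.map_apply]
    simp only [Matrix.diagonal_apply, Units.val_inv_eq_inv_val, Units.val_mk0, smul_eq_mul]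
    have he : ∀ a b, ((Matrix.SpecialLinearGroup.mapGL ℚ (γ : SL(2, ℤ)) : GL (Fin 2) ℚ) :
        Matrix (Fin 2) (Fin 2) ℚ) a b = ((A a b : ℤ) : ℚ) := fun a b => rfl
    fin_cases j <;> simp [he]  <;> ring
  have hMinv : (((Matrix.SpecialLinearGroup.mapGL ℚ (γ : SL(2, ℤ)) * (Rat.scalarPrime v)⁻¹)⁻¹ : GL (Fin 2) ℚ) :
      Matrix (Fin 2) (Fin 2) ℚ) =
        (p : ℚ) • (((γ : SL(2, ℤ))⁻¹ : SL(2, ℤ)) : Matrix (Fin 2) (Fin 2) ℤ).map (Int.castRingHom ℚ) := by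
    rw [_root_.mul_inv_rev, inv_inv, Units.val_mul, Rat.coe_scalarPrime, Matrix.smul_mul, Matrix.one_mul,
      ← map_inv]
    rfl
  -- valuations of integers and of `N`-multiples
  have hint : ∀ z : ℤ, w.valuation ℚ (z : ℚ) ≤ 1 := fun z => by
    rw [← map_intCast (algebraMap (𝓞 ℚ) ℚ), HeightOneSpectrum.valuation_of_algebraMap]
    exact HeightOneSpectrum.intValuation_le_one w _
  have hdvd : ∀ {z : ℤ}, (N : ℤ) ∣ z → w.valuation ℚ (z : ℚ) ≤ idealRadius ℚ w (Ideal.span {(N : 𝓞 ℚ)}) := by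
    rintro z ⟨m, rfl⟩
    rw [Rat.idealRadius_span_natCast w hN, Int.cast_mul, Int.cast_natCast, Valuation.map_mul]
    exact mul_le_of_le_one_right zero_le (hint m)
  have hγ0 : (A 1 0 : ZMod N) = 0 := CongruenceSubgroup.Gamma0_mem.1 γ.2
  have hγ1 : ((A 1 1 : ℤ) : ZMod N) = ((p : ℕ) : ZMod N) := hγ
  have hpv : w.valuation ℚ (p : ℚ) = 1 := Rat.valuation_natGenerator_of_ne hw
  have hq : ∀ z : ℤ, Valued.v (algebraMap ℚ (w.adicCompletion ℚ) ((p : ℚ)⁻¹ * Int.castRingHom ℚ z)) =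
      w.valuation ℚ (z : ℚ) := fun z => by
    rw [hval, Valuation.map_mul, Valuation.map_inv, hpv, inv_one, one_mul, eq_intCast]
  have hq' : ∀ z : ℤ, Valued.v (algebraMap ℚ (w.adicCompletion ℚ) ((p : ℚ) * Int.castRingHom ℚ z)) =
      w.valuation ℚ (z : ℚ) := fun z => by
    rw [hval, Valuation.map_mul, hpv, one_mul, eq_intCast]
  rw [Rat.mem_localGammaOne_iff]
  refine ⟨fun i j => ?_, fun i j => ?_, ?_, ?_⟩
  · rw [Rat.coe_globalToLocal_apply, hM, Matrix.smul_apply, Matrix.map_apply, smul_eq_mul, hq]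
    exact hint _
  · rw [← map_inv, Rat.coe_globalToLocal_apply, hMinv, Matrix.smul_apply, Matrix.map_apply, smul_eq_mul, hq']
    exact hint _
  · rw [Rat.coe_globalToLocal_apply, hM, Matrix.smul_apply, Matrix.map_apply, smul_eq_mul, hq]
    exact hdvd ((ZMod.intCast_zmod_eq_zero_iff_dvd _ N).1 hγ0)
  · rw [Rat.coe_globalToLocal_apply, hM, Matrix.smul_apply, Matrix.map_apply, smul_eq_mul]
    have e : algebraMap ℚ (w.adicCompletion ℚ) ((p : ℚ)⁻¹ * Int.castRingHom ℚ (A 1 1)) - 1 =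
        algebraMap ℚ (w.adicCompletion ℚ) ((p : ℚ)⁻¹ * Int.castRingHom ℚ (A 1 1 - p)) := by
      rw [← (algebraMap ℚ (w.adicCompletion ℚ)).map_one, ← map_sub]
      congr 1
      simp only [eq_intCast]
      push_cast
      field_simp
    rw [e, hq]
    refine hdvd ((ZMod.intCast_zmod_eq_zero_iff_dvd _ N).1 ?_)
    push_cast
    rw [hγ1, sub_self]

end AwayFromP

end Literature.NumberTheory.Automorphic
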